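import Literature.Analysis.FluidPDE.SelfSimilarEulerProfileWeakPoisson
import Literature.Analysis.FluidPDE.SelfSimilarEulerTwoScaleIdentity
import HarnessLib

/-!
# Bronzi–Shvydkoy 2015, Theorem 1.1 and Remark 1.3 for `L^p` profiles: the energy of a
# non-trivial self-similar Euler profile is bounded BELOW, `∫_{|y|<L} |U|² ≳ L^{3−2α}`

Analysis/FluidPDE proof file (theorems only; no definitions, no named facts, no `sorry`) in the
story of `SelfSimilarEulerEnergyConcentration.lean` (the NAMED FACT
`bronziShvydkoy2015_energy_dichotomy` = A. Bronzi, R. Shvydkoy, *On the energy behavior of locally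
self-similar blowup for the Euler equation*, Indiana Univ. Math. J. **64** (2015) 1291–1302 =
arXiv:1310.8611 [BronziShvydkoy2015], **Theorem 1.1**) and of `SelfSimilarEulerLpExclusion.lean`
(Chae–Shvydkoy 2013 [ChaeShvydkoy2013], whose Theorem 3.2 and Corollary 3.4 are theorems of the
tree: `chaeShvydkoy2013_Lp_exclusion_holds`, `chaeShvydkoy2013_energy_growth_holds`).

BS15, Theorem 1.1 (`N = 3`): a locally self-similar blow-up profile `v ∈ C³_loc` with
`0 < α < 3/2` and the shell growth `∫_{|y|∼L} |v|^p ≲ L^γ`, `p ≥ 3`, `γ < p − 2`, is either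
trivial or carries the two-sided energy law `L^{3−2α} ≲ ∫_{|y|<L} |v|² ≲ L^{3−2α}`; Remark 1.3:
"if in addition `γ < N − pα` … This implies `v = 0` … in the range `N/p < α < N/2`, Theorem 1.1
provides an extension of [Chae–Shvydkoy's] result by requesting an extra decay of the `L^p`-norms
over the shells".  The printed proof (§3, held text p. 7) runs at the level of the PROFILE pair
`(v, q)` solving the self-similar Euler system (2.3) (the tree's
`IsSelfSimilarEulerProfile (1/(α+1)) 0 U P`), from three inputs: (a) the two-scale local energy
inequality of [ChaeShvydkoy2013] (2.9), (b) the energy bound `∫_{|y|<L}|v|² ≲ L^{3−2α}` ((1.6),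
from the ambient finite energy), (c) the dyadic pressure bound (2.4) of Lemma 2.1.

This file proves Theorem 1.1 and Remark 1.3 for profiles with `U ∈ L^p(ℝ³)`, `P ∈ L^{p/2}(ℝ³)`,
`3 ≤ p < ∞`, in the window `3/p < α ≤ 3/2` left open by Chae–Shvydkoy's Theorem 3.2 — the class
of `SelfSimilarEulerLpExclusion.lean`, in which (b) IS Corollary 3.4
(`IsSelfSimilarEulerProfile.energyGrowth_of_memLp_of_window`, no ambient solution needed), (c) is
the tree's local pressure bound behind `setIntegral_flux_le_of_growth` (CS13 Lemma 3.3,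
`AssociatedPressureLocalBound.lean`), and (a) is the exact dyadic two-scale identity
`IsSelfSimilarEulerProfile.twoScale_energy_dyadic` (`SelfSimilarEulerTwoScaleIdentity.lean`);
the shell-growth hypothesis (1.7) then holds with `γ = 0 < p − 2`.  Following §3 verbatim:

* `IsSelfSimilarEulerProfile.twoScaleEnergy_le_dyadicFlux_of_frequently_small` — BS15 §3, first
  display: "Assuming, on the contrary, that there is a sequence of `L_n`'s so that
  `L_n^{2α}⟨|v|²⟩_{L_n} → 0` we let `l₂ = L_n` and as a result in the limit obtain
  `⟨|v|²⟩_L ≲ L^{−2α} ∫_{|y|>L} (|v|³+|q||v|)|y|^{2α−N−1}`" — here for EVERY `C²` profile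
  (`−1 < α ≤ 3/2`, no integrability of `U`, `P` at infinity): if `L^{2α−3}∫_{|y|<L}|U|²` is
  frequently small, then `l^{2α−3}∫_{|y|<l/2}|U|²` is bounded by the dyadic weighted flux sums
  `Σ_j (2^j l)^{2α−4} ∫_{(2^j l)²/2 ≤ |y|² ≤ 4(2^j l)²} (|U|³ + 2|P||U|)`;
* `IsSelfSimilarEulerProfile.energyGrowth_step_of_frequently_small` — one round of the
  bootstrap under that hypothesis (BS15 §3 "we initiate a bootstrap procedure on decay rates";
  in the `L^p` class the recursion is Chae–Shvydkoy's `a ↦ α_p a − 1`, `α_p = (p−3)/(p−2)`,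
  fed by `setIntegral_flux_le_of_growth`, now WITHOUT the hypothesis `α ≤ 3/p`);
* `IsSelfSimilarEulerProfile.eq_zero_of_memLp_of_frequently_small` — `3 ≤ p < ∞`,
  `3/p < α ≤ 3/2`, `U ∈ L^p`, `P ∈ L^{p/2}`: if `liminf_L L^{2α−3}∫_{|y|<L}|U|² = 0` then `U = 0`
  (start `a₀ = 3 − 2α` from Corollary 3.4, finitely many rounds, a negative exponent forces
  `U = 0` by `eq_zero_of_energyGrowth_of_three_halves_lt`);
* `IsSelfSimilarEulerProfile.energy_lower_bound_of_memLp`,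
  `IsSelfSimilarEulerProfile.energy_dichotomy_of_memLp` — **BS15 Theorem 1.1 in the `L^p`
  class**: `U = 0`, or `c L^{3−2α} ≤ ∫_{|y|<L}|U|² ≤ C L^{3−2α}` for all large `L` with `c > 0`
  (the conclusion shape of `bronziShvydkoy2015_energy_dichotomy`);
* `IsSelfSimilarEulerProfile.eq_zero_of_memLp_of_shellDecay` — **BS15 Remark 1.3**: if moreover
  `∫_{L<|y|<2L} |U|^p ≤ C L^γ` for large `L` with `γ < 3 − pα`, then `U = 0` (Hölder on the
  shells makes the energy `o(L^{3−2α})`): an exclusion INSIDE the window `3/p < α < 3/2`;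
* `ball_energy_le_of_shellEnergy_le`, `energy_eventually_small_of_decay`,
  `IsSelfSimilarEulerProfile.eq_zero_of_memLp_of_decay` (+ `…_three_…`, `…_energy_littleO`,
  `bronziShvydkoy2015_exclusion_of_decay`) — **BS15 Remark 1.4 in kernel form**: an `L^p`
  profile in the window whose velocity decays pointwise FASTER than the natural rate `|y|^{−α}`
  (`|y|^α |U(y)| → 0`) is trivial;
* primed versions without the weak-Poisson hypothesis (automatic for `C²` profiles,
  `IsSelfSimilarEulerProfile.weakPoisson`) and `ℝ≥0∞`-exponent versions in the binder shape of
  the Chae–Shvydkoy facts;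
* `energy_ball_lower_bound_of_selfSimilarCollapse_of_memLp` — **BS15 Remark 1.2 (energy
  concentration) for `L^p` profiles, WITHOUT the named fact**: if a field `u` equals the collapse
  `(T−t)^{γ−1} v((T−t)^{−γ}(x − x₀))` on `B_{ρ₀}(x₀) × [0,T)` with a non-trivial `L^p` profile
  `(v, q)` in the window, then `∫_{B_{ρ₀}(x₀)} |u(t)|² ≥ c ρ₀^{3−2α} > 0` for all `t` near `T`
  (the fact-conditional `bronziShvydkoy2015_energy_dichotomy.energy_ball_lower_bound` of
  `SelfSimilarEulerEnergyConcentration.lean`, made unconditional in the `L^p` class).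

What is NOT here (recorded so the gap is explicit): the AMBIENT statement
`bronziShvydkoy2015_energy_dichotomy` for profiles NOT in any `L^p` (shell growth `0 ≤ γ < p − 2`)
— its discharge additionally needs BS15 Lemma 2.1 (recovery of the self-similar pressure and the
dyadic bound (2.4) from Calderón–Zygmund on shells, for fields with only the dyadic energy decay
(1.6)) and the energy conservation of the ambient Beale–Kato–Majda solution; neither is attempted
in this file.  For the census of exact self-similar Euler profiles (ns-blowup zones Z5–Z8): in the
window `2/5 ≤ c_l = 1/(1+α) < p/(p+3)` a non-trivial `L^p` profile has ball energies EXACTLY of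
order `L^{5 − 2/c_l}` (at the parabolic gauge `c_l = ½`: `∫_{|y|<L}|U|² ≍ L`), and an `L^p` shell
mass decaying faster than the natural rate `L^{3−pα}` forces `U = 0`.

## Mathlib / tree search

`lean search 'bronziShvydkoy|energy_lower|liminf.*ball'`: only the fact file
`SelfSimilarEulerEnergyConcentration.lean` (fact + Remark 1.2 relative to it); no profile-level
lower bound in the tree (2026-08-27). Reused: `IsSelfSimilarEulerProfile.twoScale_energy_dyadic`,
`ball_energy_le_twoScaleEnergy`, `twoScaleEnergy_le_ball_energy`
(`SelfSimilarEulerTwoScaleIdentity.lean`); `setIntegral_flux_le_of_growth`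
(`SelfSimilarEulerLpExclusionHolds.lean`); `IsSelfSimilarEulerProfile.energyGrowth_of_memLp_of_window`
(`SelfSimilarEulerEnergyGrowth.lean`); `eq_zero_of_energyGrowth_of_three_halves_lt`
(`SelfSimilarEulerLpExclusion.lean`); `IsSelfSimilarEulerProfile.weakPoisson`; Mathlib
`exists_nat_pow_near`, `Real.rpow_le_rpow_of_nonpos`, `geom_sum_mul_neg`,
`MeasureTheory.integral_mul_le_Lp_mul_Lq_of_nonneg`, `Measure.addHaar_sphere`. No new
definitions, no instances, no notation.

## References

* A. Bronzi, R. Shvydkoy, Indiana Univ. Math. J. 64 (2015) 1291–1302 = arXiv:1310.8611, §1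
  Thm. 1.1, Rem. 1.2, Rem. 1.3, Rem. 1.4; §3 (proof of Thm. 1.1, Claim 3.1). [BronziShvydkoy2015]
* D. Chae, R. Shvydkoy, ARMA 209 (2013) = arXiv:1201.6009, §2.2 eq. (2.9), §3.2 Thm. 3.2,
  Lemma 3.3, Cor. 3.4. [ChaeShvydkoy2013]
-/

noncomputable section

open MeasureTheory Set Filter Topology Metric
open scoped ENNReal NNReal Laplacian

namespace Literature.Analysis.FluidPDE

/-! ## Elementary helpers -/

/-- `(2^j)^d = (2^d)^j` for real `d` and natural `j`. [folklore] -/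
private theorem two_pow_rpow_comm (d : ℝ) (j : ℕ) :
    ((2 : ℝ) ^ j) ^ d = ((2 : ℝ) ^ d) ^ j := by
  rw [← Real.rpow_natCast 2 j, ← Real.rpow_mul (by norm_num : (0 : ℝ) ≤ 2), mul_comm,
    Real.rpow_mul (by norm_num : (0 : ℝ) ≤ 2), Real.rpow_natCast]

/-- Partial sums of a geometric series with ratio `0 ≤ q < 1` are at most `(1 − q)⁻¹`. [folklore] -/
private theorem geom_partial_sum_le {q : ℝ} (hq0 : 0 ≤ q) (hq1 : q < 1) (k : ℕ) :
    ∑ j ∈ Finset.range k, q ^ j ≤ (1 - q)⁻¹ := by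
  have h1 : 0 < 1 - q := by linarith
  have hmul : (∑ j ∈ Finset.range k, q ^ j) * (1 - q) ≤ 1 := by
    rw [geom_sum_mul_neg]
    linarith [pow_nonneg hq0 k]
  calc ∑ j ∈ Finset.range k, q ^ j
      = (∑ j ∈ Finset.range k, q ^ j) * (1 - q) / (1 - q) := by field_simp
    _ ≤ 1 / (1 - q) := div_le_div_of_nonneg_right hmul h1.le
    _ = (1 - q)⁻¹ := one_div _

/-! ## BS15 §3, first display: the reversed two-scale inequality under the contradiction
hypothesis `liminf_L L^{2α−3} ∫_{|y|<L} |U|² = 0` -/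

/-- **Bronzi–Shvydkoy 2015, §3, first display (profile level, every `C²` profile).** Let
`(U, P)` be a stationary self-similar Euler profile with exponent `γ = 1/(α+1)`,
`−1 < α ≤ 3/2`, and suppose the rescaled ball energies `L^{2α−3} ∫_{|y|<L} |U|²` are
FREQUENTLY SMALL as `L → ∞` ("there is a sequence of `L_n`'s so that `L_n^{2α−N}∫_{|y|<L_n}|v|²
→ 0`"). Then for every `l > 0` the rescaled energy at scale `l` is bounded by the dyadic weighted
flux beyond `l`: if `Σ_{j<k} (2^j l)^{2α−4} ∫_{(2^j l)²/2 ≤ |y|² ≤ 4(2^j l)²} (|U|³ + 2|P||U|) ≤ B`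
for all `k`, then `l^{2α−3} ∫_{|y|<l/2} |U|² ≤ C B` with `C` depending on `α` only ("we let
`l₂ = L_n` and as a result in the limit obtain `⟨|v|²⟩_L ≲ L^{−2α}∫_{|y|>L}(|v|³+|q||v|)
|y|^{2α−N−1} dy`"). Proof: Chae–Shvydkoy's dyadic two-scale identity
(`twoScale_energy_dyadic`) between `l` and `2^n l ∈ (L/4, L/2]`, where the cut-off energy at the
large scale is `≤ 4^{3−2α} L^{2α−3}∫_{|y|<L}|U|²`, which is as small as we please along the
hypothesis. No integrability of `U`, `P` at infinity is assumed (the bound may be vacuous).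
[cite: BronziShvydkoy2015, §3 (proof of Thm. 1.1, first display); ChaeShvydkoy2013, §2.2 eq. (2.9)] -/
theorem IsSelfSimilarEulerProfile.twoScaleEnergy_le_dyadicFlux_of_frequently_small {α : ℝ}
    {U : EuclideanSpace ℝ (Fin 3) → EuclideanSpace ℝ (Fin 3)} {P : EuclideanSpace ℝ (Fin 3) → ℝ}
    (h : IsSelfSimilarEulerProfile (1 / (α + 1)) 0 U P) (hα : -1 < α) (hα2 : α ≤ 3 / 2)
    (hsmall : ∀ ε : ℝ, 0 < ε → ∀ M : ℝ, ∃ L : ℝ, M ≤ L ∧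
      L ^ (2 * α - 3) * ∫ y in ball (0 : EuclideanSpace ℝ (Fin 3)) L, ‖U y‖ ^ 2 ≤ ε) :
    ∃ C : ℝ, 0 ≤ C ∧ ∀ l : ℝ, 0 < l → ∀ B : ℝ,
      (∀ k : ℕ, ∑ j ∈ Finset.range k, (2 ^ j * l) ^ (2 * α - 4) *
          ∫ y in {y : EuclideanSpace ℝ (Fin 3) |
              (2 ^ j * l) ^ 2 / 2 ≤ ‖y‖ ^ 2 ∧ ‖y‖ ^ 2 ≤ 4 * (2 ^ j * l) ^ 2},
            (‖U y‖ ^ 3 + 2 * (|P y| * ‖U y‖)) ≤ B) →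
      l ^ (2 * α - 3) * ∫ y in ball (0 : EuclideanSpace ℝ (Fin 3)) (l / 2), ‖U y‖ ^ 2 ≤ C * B := by
  have hα0 : α + 1 ≠ 0 := by
    intro h0
    linarith
  have hUc : Continuous U := h.contDiff_velocity.continuous
  have he : 2 * α - 3 ≤ 0 := by linarith
  obtain ⟨C, hC0, hdy⟩ := h.twoScale_energy_dyadic hα0
  refine ⟨C, hC0, fun l hl B hB => ?_⟩
  -- the cut-off energy `E(λ) = λ^{2α−3} ∫ σ(|y|²/λ²) |U|²`
  set E : ℝ → ℝ := fun lam =>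
    lam ^ (2 * α - 3) * ∫ y, Real.smoothTransition (2 - 2 * (‖y‖ ^ 2 / lam ^ 2)) * ‖U y‖ ^ 2
    with hE_def
  -- the constant `D = 4^{3−2α}` converting the scale `2^n l ∈ (L/4, L/2]` to the scale `L`
  set D : ℝ := (4 : ℝ) ^ (3 - 2 * α) with hD_def
  have hD : 0 < D := by positivity
  refine le_of_forall_pos_le_add fun ε hε => ?_
  obtain ⟨L, hML, hL⟩ := hsmall (ε / D) (by positivity) (2 * l)
  have hL0 : 0 < L := by linarith
  -- `2^n ≤ L/(2l) < 2^{n+1}`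
  have hx : 1 ≤ L / (2 * l) := by
    rw [le_div_iff₀ (by positivity)]
    linarith
  obtain ⟨n, hn1, hn2⟩ := exists_nat_pow_near hx one_lt_two
  set lam : ℝ := 2 ^ n * l with hlam_def
  have hlam : 0 < lam := by positivity
  have h2lam : 2 * lam ≤ L := by
    have := (le_div_iff₀ (by positivity : (0 : ℝ) < 2 * l)).1 hn1
    rw [hlam_def]
    linarith
  have hlam4 : L / 4 < lam := by
    have := (div_lt_iff₀ (by positivity : (0 : ℝ) < 2 * l)).1 hn2
    rw [hlam_def, pow_succ] at *
    linarith
  -- the two-scale identity between `l` and `λ = 2^n l`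
  have htwo : |E lam - E l| ≤ C * B := by
    have h1 := hdy l hl n
    have h2 := hB n
    calc |E lam - E l| ≤ C * ∑ j ∈ Finset.range n, (2 ^ j * l) ^ (2 * α - 4) *
          ∫ y in {y : EuclideanSpace ℝ (Fin 3) |
              (2 ^ j * l) ^ 2 / 2 ≤ ‖y‖ ^ 2 ∧ ‖y‖ ^ 2 ≤ 4 * (2 ^ j * l) ^ 2},
            (‖U y‖ ^ 3 + 2 * (|P y| * ‖U y‖)) := h1
      _ ≤ C * B := mul_le_mul_of_nonneg_left h2 hC0
  -- the cut-off energy at the large scale is small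
  have hint : ∀ R : ℝ, IntegrableOn (fun y => ‖U y‖ ^ 2) (ball (0 : EuclideanSpace ℝ (Fin 3)) R)
      volume := fun R =>
    ((hUc.norm.pow 2).continuousOn.integrableOn_compact (isCompact_closedBall 0 R)).mono_set
      ball_subset_closedBall
  have hElam : E lam ≤ ε := by
    have h1 : E lam ≤ lam ^ (2 * α - 3) *
        ∫ y in ball (0 : EuclideanSpace ℝ (Fin 3)) (2 * lam), ‖U y‖ ^ 2 :=
      twoScaleEnergy_le_ball_energy hUc hlam
    have h2 : ∫ y in ball (0 : EuclideanSpace ℝ (Fin 3)) (2 * lam), ‖U y‖ ^ 2 ≤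
        ∫ y in ball (0 : EuclideanSpace ℝ (Fin 3)) L, ‖U y‖ ^ 2 :=
      setIntegral_mono_set (hint L) (ae_of_all _ fun y => by positivity)
        (ae_of_all _ (ball_subset_ball h2lam))
    have h3 : lam ^ (2 * α - 3) ≤ (L / 4) ^ (2 * α - 3) :=
      Real.rpow_le_rpow_of_nonpos (by positivity) hlam4.le he
    have h4 : (L / 4) ^ (2 * α - 3) = D * L ^ (2 * α - 3) := by
      rw [Real.div_rpow hL0.le (by norm_num), hD_def, div_eq_mul_inv, ← Real.rpow_neg
        (by norm_num : (0 : ℝ) ≤ 4), show -(2 * α - 3) = 3 - 2 * α by ring, mul_comm]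
    have hEL : 0 ≤ ∫ y in ball (0 : EuclideanSpace ℝ (Fin 3)) L, ‖U y‖ ^ 2 :=
      integral_nonneg fun y => by positivity
    calc E lam ≤ lam ^ (2 * α - 3) *
          ∫ y in ball (0 : EuclideanSpace ℝ (Fin 3)) (2 * lam), ‖U y‖ ^ 2 := h1
      _ ≤ (L / 4) ^ (2 * α - 3) * ∫ y in ball (0 : EuclideanSpace ℝ (Fin 3)) L, ‖U y‖ ^ 2 :=
          mul_le_mul h3 h2 (integral_nonneg fun y => by positivity)
            (Real.rpow_nonneg (by positivity) _)
      _ = D * (L ^ (2 * α - 3) * ∫ y in ball (0 : EuclideanSpace ℝ (Fin 3)) L, ‖U y‖ ^ 2) := by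
          rw [h4, mul_assoc]
      _ ≤ D * (ε / D) := mul_le_mul_of_nonneg_left hL hD.le
      _ = ε := mul_div_cancel₀ ε hD.ne'
  -- the cut-off energy at scale `l` dominates the half-ball energy
  have hEl : l ^ (2 * α - 3) * ∫ y in ball (0 : EuclideanSpace ℝ (Fin 3)) (l / 2), ‖U y‖ ^ 2 ≤
      E l := ball_energy_le_twoScaleEnergy hUc hl
  have habs := neg_abs_le (E lam - E l)
  linarith [hEl, htwo, hElam, habs, le_abs_self (E lam - E l)]

/-! ## The dyadic weighted flux sums from a local flux growth bound -/

/-- **Dyadic weighted flux sums from local flux growth.** If the local flux obeys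
`∫_{|y|≤R} (|U|³ + 2|P||U|) ≤ C_f R^b` for `R ≥ 1` and `2α − 4 + b < 0`, then for `l ≥ 1` and
every `k`, `Σ_{j<k} (2^j l)^{2α−4} ∫_{(2^j l)²/2 ≤ |y|² ≤ 4(2^j l)²} (|U|³ + 2|P||U|)
≤ C_f 2^b (1 − 2^{2α−4+b})⁻¹ l^{2α−4+b}` (the `j`-th shell lies in the ball of radius `2^{j+1} l`;
geometric series). This is the summation "`Σ_k 2^{−k(1−2α)} ⟨·⟩_{2^kL, 2^{k+1}L}`" of BS15 (3.1) /
CS13 (3.7). [cite: BronziShvydkoy2015, §3 eq. (3.1); ChaeShvydkoy2013, §3.2.1 eq. (3.7)] -/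
theorem sum_dyadicFlux_le_of_flux_growth {α b C_f : ℝ}
    {U : EuclideanSpace ℝ (Fin 3) → EuclideanSpace ℝ (Fin 3)} {P : EuclideanSpace ℝ (Fin 3) → ℝ}
    (hUc : Continuous U) (hPloc : LocallyIntegrable P volume) (hCf : 0 ≤ C_f)
    (he : 2 * α - 4 + b < 0)
    (hF : ∀ R : ℝ, 1 ≤ R →
      ∫ y in closedBall (0 : EuclideanSpace ℝ (Fin 3)) R, (‖U y‖ ^ 3 + 2 * (|P y| * ‖U y‖)) ≤
        C_f * R ^ b)
    {l : ℝ} (hl : 1 ≤ l) (k : ℕ) :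
    ∑ j ∈ Finset.range k, (2 ^ j * l) ^ (2 * α - 4) *
        ∫ y in {y : EuclideanSpace ℝ (Fin 3) |
            (2 ^ j * l) ^ 2 / 2 ≤ ‖y‖ ^ 2 ∧ ‖y‖ ^ 2 ≤ 4 * (2 ^ j * l) ^ 2},
          (‖U y‖ ^ 3 + 2 * (|P y| * ‖U y‖)) ≤
      C_f * 2 ^ b * (1 - (2 : ℝ) ^ (2 * α - 4 + b))⁻¹ * l ^ (2 * α - 4 + b) := by
  have hl0 : 0 < l := by linarith
  set e : ℝ := 2 * α - 4 + b with he_def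
  set f : EuclideanSpace ℝ (Fin 3) → ℝ := fun y => ‖U y‖ ^ 3 + 2 * (|P y| * ‖U y‖) with hf_def
  have hf0 : ∀ y, 0 ≤ f y := fun y => by positivity
  have hfi : ∀ R : ℝ, IntegrableOn f (closedBall (0 : EuclideanSpace ℝ (Fin 3)) R) volume := by
    intro R
    have hK : IsCompact (closedBall (0 : EuclideanSpace ℝ (Fin 3)) R) := isCompact_closedBall _ _
    have hPi : IntegrableOn (fun y => |P y|) (closedBall (0 : EuclideanSpace ℝ (Fin 3)) R)
        volume := (hPloc.integrableOn_isCompact hK).norm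
    exact ((hUc.norm.pow 3).continuousOn.integrableOn_compact hK).add
      ((hPi.mul_continuousOn hUc.norm.continuousOn hK).const_mul 2)
  -- the ratio of the geometric series
  have hq0 : 0 ≤ (2 : ℝ) ^ e := by positivity
  have hq1 : (2 : ℝ) ^ e < 1 := Real.rpow_lt_one_of_one_lt_of_neg (by norm_num) he
  -- each shell term
  have hterm : ∀ j : ℕ, (2 ^ j * l) ^ (2 * α - 4) *
      ∫ y in {y : EuclideanSpace ℝ (Fin 3) |
          (2 ^ j * l) ^ 2 / 2 ≤ ‖y‖ ^ 2 ∧ ‖y‖ ^ 2 ≤ 4 * (2 ^ j * l) ^ 2}, f y ≤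
        C_f * 2 ^ b * l ^ e * ((2 : ℝ) ^ e) ^ j := by
    intro j
    have hr : (0 : ℝ) < 2 ^ j * l := by positivity
    have hR0 : (0 : ℝ) < 2 ^ (j + 1) * l := by positivity
    have hR1 : (1 : ℝ) ≤ 2 ^ (j + 1) * l := by
      have : (1 : ℝ) ≤ 2 ^ (j + 1) := one_le_pow₀ (by norm_num)
      nlinarith
    -- the shell lies in the closed ball of radius `2^{j+1} l`
    have hsub : {y : EuclideanSpace ℝ (Fin 3) |
        (2 ^ j * l) ^ 2 / 2 ≤ ‖y‖ ^ 2 ∧ ‖y‖ ^ 2 ≤ 4 * (2 ^ j * l) ^ 2} ⊆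
        closedBall (0 : EuclideanSpace ℝ (Fin 3)) (2 ^ (j + 1) * l) := by
      intro y hy
      rw [mem_closedBall_zero_iff]
      have h2 : (2 : ℝ) ^ (j + 1) * l = 2 * (2 ^ j * l) := by
        rw [pow_succ]
        ring
      have hy2 : ‖y‖ ^ 2 ≤ (2 ^ (j + 1) * l) ^ 2 := by
        rw [h2]
        nlinarith [hy.2]
      by_contra hcon
      push Not at hcon
      nlinarith [norm_nonneg y]
    have hshell : ∫ y in {y : EuclideanSpace ℝ (Fin 3) |
        (2 ^ j * l) ^ 2 / 2 ≤ ‖y‖ ^ 2 ∧ ‖y‖ ^ 2 ≤ 4 * (2 ^ j * l) ^ 2}, f y ≤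
        C_f * (2 ^ (j + 1) * l) ^ b :=
      (setIntegral_mono_set (hfi _) (ae_of_all _ hf0) (ae_of_all _ hsub)).trans (hF _ hR1)
    have hpow : (2 ^ j * l) ^ (2 * α - 4) * (2 ^ (j + 1) * l) ^ b =
        2 ^ b * l ^ e * ((2 : ℝ) ^ e) ^ j := by
      rw [Real.mul_rpow (by positivity) hl0.le, Real.mul_rpow (by positivity) hl0.le,
        pow_succ, Real.mul_rpow (by positivity) (by norm_num), ← two_pow_rpow_comm e j,
        he_def, Real.rpow_add (by positivity : (0 : ℝ) < 2 ^ j), Real.rpow_add hl0]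
      ring
    calc (2 ^ j * l) ^ (2 * α - 4) *
          ∫ y in {y : EuclideanSpace ℝ (Fin 3) |
            (2 ^ j * l) ^ 2 / 2 ≤ ‖y‖ ^ 2 ∧ ‖y‖ ^ 2 ≤ 4 * (2 ^ j * l) ^ 2}, f y
        ≤ (2 ^ j * l) ^ (2 * α - 4) * (C_f * (2 ^ (j + 1) * l) ^ b) :=
          mul_le_mul_of_nonneg_left hshell (Real.rpow_nonneg hr.le _)
      _ = C_f * ((2 ^ j * l) ^ (2 * α - 4) * (2 ^ (j + 1) * l) ^ b) := by ring
      _ = C_f * 2 ^ b * l ^ e * ((2 : ℝ) ^ e) ^ j := by rw [hpow]; ring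
  calc ∑ j ∈ Finset.range k, (2 ^ j * l) ^ (2 * α - 4) *
        ∫ y in {y : EuclideanSpace ℝ (Fin 3) |
            (2 ^ j * l) ^ 2 / 2 ≤ ‖y‖ ^ 2 ∧ ‖y‖ ^ 2 ≤ 4 * (2 ^ j * l) ^ 2}, f y
      ≤ ∑ j ∈ Finset.range k, C_f * 2 ^ b * l ^ e * ((2 : ℝ) ^ e) ^ j :=
        Finset.sum_le_sum fun j _ => hterm j
    _ = C_f * 2 ^ b * l ^ e * ∑ j ∈ Finset.range k, ((2 : ℝ) ^ e) ^ j := by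
        rw [Finset.mul_sum]
    _ ≤ C_f * 2 ^ b * l ^ e * (1 - (2 : ℝ) ^ e)⁻¹ :=
        mul_le_mul_of_nonneg_left (geom_partial_sum_le hq0 hq1 k) (by positivity)
    _ = C_f * 2 ^ b * (1 - (2 : ℝ) ^ e)⁻¹ * l ^ e := by ring

/-! ## One round of the bootstrap under the contradiction hypothesis -/

/-- **Bootstrap round under the contradiction hypothesis** (BS15 §3, "we initiate a bootstrap
procedure on decay rates of the `L³` and `L²`-averages", in the `L^p` class). For `p > 3`, a
profile with `U ∈ L^p`, `P ∈ L^{p/2}` (weak Poisson), `−1 < α ≤ 3/2`, whose rescaled ball energies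
are frequently small: if `∫_{|y|<R}|U|² ≤ C R^a` for `R ≥ 1` with `0 ≤ a ≤ 3 − 6/p` and
`a ≤ 3 − 2α`, then `∫_{|y|<R}|U|² ≤ C' R^{α_p a − 1}` for `R ≥ 1`, `α_p = (p−3)/(p−2)` — the local
flux bound `∫_{|y|≤ρ}(|U|³ + 2|P||U|) ≲ ρ^{α_p a}` (`setIntegral_flux_le_of_growth`, CS13 Lemma 3.3
+ interpolation) summed over dyadic shells (`sum_dyadicFlux_le_of_flux_growth`, convergent since
`α_p a + 2α − 4 ≤ a + 2α − 4 ≤ −1`) and fed into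
`twoScaleEnergy_le_dyadicFlux_of_frequently_small`. This is Chae–Shvydkoy's round
`energyGrowth_step_of_le` with the hypothesis `α ≤ 3/p` REPLACED by the smallness of the energy
along a sequence of scales. [cite: BronziShvydkoy2015, §3 (proof of Thm. 1.1, eq. (3.1) and the
bootstrap); ChaeShvydkoy2013, §3.2.1 eqs. (3.2), (3.7)] -/
theorem IsSelfSimilarEulerProfile.energyGrowth_step_of_frequently_small {α p a C : ℝ}
    {U : EuclideanSpace ℝ (Fin 3) → EuclideanSpace ℝ (Fin 3)} {P : EuclideanSpace ℝ (Fin 3) → ℝ}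
    (h : IsSelfSimilarEulerProfile (1 / (α + 1)) 0 U P) (hα : -1 < α) (hα2 : α ≤ 3 / 2)
    (hp : 3 < p) (hU : MemLp U (ENNReal.ofReal p) volume)
    (hP : MemLp P (ENNReal.ofReal (p / 2)) volume)
    (hPoisson : ∀ φ : EuclideanSpace ℝ (Fin 3) → ℝ, ContDiff ℝ (⊤ : ℕ∞) φ → HasCompactSupport φ →
      ∫ x, P x * (Δ φ) x = -∫ x, fderiv ℝ (fderiv ℝ φ) x (U x) (U x))
    (hsmall : ∀ ε : ℝ, 0 < ε → ∀ M : ℝ, ∃ L : ℝ, M ≤ L ∧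
      L ^ (2 * α - 3) * ∫ y in ball (0 : EuclideanSpace ℝ (Fin 3)) L, ‖U y‖ ^ 2 ≤ ε)
    (hC : 0 ≤ C) (ha0 : 0 ≤ a) (ha : a ≤ 3 - 6 / p) (ha' : a ≤ 3 - 2 * α)
    (hG : ∀ R : ℝ, 1 ≤ R →
      ∫ y in ball (0 : EuclideanSpace ℝ (Fin 3)) R, ‖U y‖ ^ 2 ≤ C * R ^ a) :
    ∃ C' : ℝ, 0 ≤ C' ∧ ∀ R : ℝ, 1 ≤ R →
      ∫ y in ball (0 : EuclideanSpace ℝ (Fin 3)) R, ‖U y‖ ^ 2 ≤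
        C' * R ^ ((p - 3) / (p - 2) * a - 1) := by
  have hp2 : 0 < p - 2 := by linarith
  have hUc : Continuous U := h.contDiff_velocity.continuous
  have hPloc : LocallyIntegrable P volume :=
    hP.locallyIntegrable (by
      rw [← ENNReal.ofReal_one]
      exact ENNReal.ofReal_le_ofReal (by linarith))
  set κ : ℝ := (p - 3) / (p - 2) with hκ
  have hκ0 : 0 ≤ κ := div_nonneg (by linarith) hp2.le
  have hκ1 : κ ≤ 1 := by
    rw [hκ, div_le_one hp2]
    linarith
  set b : ℝ := κ * a with hb_def
  have hb0 : 0 ≤ b := mul_nonneg hκ0 ha0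
  have hba : b ≤ a := by
    have := mul_le_mul_of_nonneg_right hκ1 ha0
    rwa [one_mul] at this
  set e : ℝ := 2 * α - 4 + b with he_def
  have he : e < 0 := by
    rw [he_def]
    linarith
  obtain ⟨C_A, hCA0, hA⟩ := h.twoScaleEnergy_le_dyadicFlux_of_frequently_small hα hα2 hsmall
  obtain ⟨C_f, hCf0, hCf⟩ := setIntegral_flux_le_of_growth hp hC ha hUc hU hP hPoisson hG
  have hq1 : (2 : ℝ) ^ e < 1 := Real.rpow_lt_one_of_one_lt_of_neg (by norm_num) he
  have hinv : 0 ≤ (1 - (2 : ℝ) ^ e)⁻¹ := inv_nonneg.2 (by linarith)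
  set K : ℝ := C_f * 2 ^ b * (1 - (2 : ℝ) ^ e)⁻¹ with hK_def
  have hK0 : 0 ≤ K := by positivity
  refine ⟨C_A * K * 2 ^ (b - 1), by positivity, fun R hR => ?_⟩
  have hR0 : 0 < R := by linarith
  set l : ℝ := 2 * R with hl_def
  have hl1 : 1 ≤ l := by rw [hl_def]; linarith
  have hl0 : 0 < l := by linarith
  -- the dyadic flux sums at scale `l = 2R`
  have hB : ∀ k : ℕ, ∑ j ∈ Finset.range k, (2 ^ j * l) ^ (2 * α - 4) *
      ∫ y in {y : EuclideanSpace ℝ (Fin 3) |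
          (2 ^ j * l) ^ 2 / 2 ≤ ‖y‖ ^ 2 ∧ ‖y‖ ^ 2 ≤ 4 * (2 ^ j * l) ^ 2},
        (‖U y‖ ^ 3 + 2 * (|P y| * ‖U y‖)) ≤ K * l ^ e := fun k => by
    have := sum_dyadicFlux_le_of_flux_growth (α := α) hUc hPloc hCf0 he hCf hl1 k
    rw [hK_def]
    exact this
  have hmain := hA l hl0 (K * l ^ e) hB
  rw [show l / 2 = R by rw [hl_def]; ring] at hmain
  -- divide by `l^{2α−3}`
  have hlpow : 0 < l ^ (2 * α - 3) := Real.rpow_pos_of_pos hl0 _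
  have hdiv : ∫ y in ball (0 : EuclideanSpace ℝ (Fin 3)) R, ‖U y‖ ^ 2 ≤
      C_A * (K * l ^ e) / l ^ (2 * α - 3) := by
    rw [le_div_iff₀ hlpow, mul_comm]
    exact hmain
  have hexp : l ^ e / l ^ (2 * α - 3) = 2 ^ (b - 1) * R ^ (b - 1) := by
    rw [← Real.rpow_sub hl0, show e - (2 * α - 3) = b - 1 by rw [he_def]; ring, hl_def,
      Real.mul_rpow (by norm_num) hR0.le]
  calc ∫ y in ball (0 : EuclideanSpace ℝ (Fin 3)) R, ‖U y‖ ^ 2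
      ≤ C_A * (K * l ^ e) / l ^ (2 * α - 3) := hdiv
    _ = C_A * K * (l ^ e / l ^ (2 * α - 3)) := by ring
    _ = C_A * K * 2 ^ (b - 1) * R ^ (b - 1) := by rw [hexp]; ring
    _ = C_A * K * 2 ^ (b - 1) * R ^ (κ * a - 1) := by rw [hb_def]

/-! ## Finitely many rounds: the contradiction hypothesis forces `U = 0` -/

/-- The exponent recursion `e₀ = β`, `e_{n+1} = κ e_n − 1` with `κ ≤ 1` reaches a negative
value (while `e_n ≥ 0`, `e_{n+1} ≤ e_n − 1`). [folklore] -/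
private theorem exists_iterate_neg' (β κ : ℝ) (hκ : κ ≤ 1) :
    ∃ n : ℕ, (fun x : ℝ => κ * x - 1)^[n] β < 0 := by
  by_contra hcon
  push Not at hcon
  have hle : ∀ n : ℕ, (fun x : ℝ => κ * x - 1)^[n] β ≤ β - n := by
    intro n
    induction n with
    | zero => simp
    | succ n ih =>
      rw [Function.iterate_succ_apply']
      have h0 := hcon n
      push_cast
      nlinarith
  obtain ⟨n, hn⟩ := exists_nat_gt β
  have h1 := hle n
  have h2 := hcon n
  linarith

/-- **BS15 Theorem 1.1, `L^p` class, contrapositive core: a frequently small rescaled energy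
forces `U = 0`.** For `3 < p < ∞`, `3/p < α ≤ 3/2`, a stationary self-similar Euler profile
`(U, P)` with exponent `γ = 1/(α+1)`, `U ∈ C² ∩ L^p(ℝ³)`, `P ∈ L^{p/2}(ℝ³)` (weak Poisson), whose
rescaled ball energies `L^{2α−3}∫_{|y|<L}|U|²` are frequently small as `L → ∞`, vanishes
identically: the energy growth starts at `a₀ = 3 − 2α` (Chae–Shvydkoy Cor. 3.4,
`energyGrowth_of_memLp_of_window`) and is improved by `a ↦ α_p a − 1`
(`energyGrowth_step_of_frequently_small`) finitely many times until the exponent is negative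
("we eventually reach the bound `∫_{|y|<L}|v|² ≲ L^{−δ}` for some `δ > 0`, which implies
`v ≡ 0`"). [cite: BronziShvydkoy2015, §3 (proof of Thm. 1.1, Claim 3.1)] -/
theorem IsSelfSimilarEulerProfile.eq_zero_of_memLp_of_frequently_small {α p : ℝ}
    {U : EuclideanSpace ℝ (Fin 3) → EuclideanSpace ℝ (Fin 3)} {P : EuclideanSpace ℝ (Fin 3) → ℝ}
    (h : IsSelfSimilarEulerProfile (1 / (α + 1)) 0 U P) (hp : 3 < p) (hαp : 3 / p < α)
    (hα2 : α ≤ 3 / 2) (hU : MemLp U (ENNReal.ofReal p) volume)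
    (hP : MemLp P (ENNReal.ofReal (p / 2)) volume)
    (hPoisson : ∀ φ : EuclideanSpace ℝ (Fin 3) → ℝ, ContDiff ℝ (⊤ : ℕ∞) φ → HasCompactSupport φ →
      ∫ x, P x * (Δ φ) x = -∫ x, fderiv ℝ (fderiv ℝ φ) x (U x) (U x))
    (hsmall : ∀ ε : ℝ, 0 < ε → ∀ M : ℝ, ∃ L : ℝ, M ≤ L ∧
      L ^ (2 * α - 3) * ∫ y in ball (0 : EuclideanSpace ℝ (Fin 3)) L, ‖U y‖ ^ 2 ≤ ε) :
    U = 0 := by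
  have hp0 : 0 < p := by linarith
  have hp2 : 0 < p - 2 := by linarith
  have h3p : 0 < 3 / p := by positivity
  have hα : -1 < α := by linarith
  have hUc : Continuous U := h.contDiff_velocity.continuous
  set κ : ℝ := (p - 3) / (p - 2) with hκ
  have hκ0 : 0 ≤ κ := div_nonneg (by linarith) hp2.le
  have hκ1 : κ ≤ 1 := by
    rw [hκ, div_le_one hp2]
    linarith
  set β : ℝ := 3 - 2 * α with hβ
  have hβ0 : 0 ≤ β := by rw [hβ]; linarith
  have hβ3 : β ≤ 3 - 6 / p := by
    rw [hβ]
    have e : (6 : ℝ) / p = 2 * (3 / p) := by ring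
    linarith
  -- the exponent sequence
  set e : ℕ → ℝ := fun n => (fun x : ℝ => κ * x - 1)^[n] β with he_def
  have he0 : e 0 = β := by simp [he_def]
  have hesucc : ∀ n, e (n + 1) = κ * e n - 1 := fun n => by
    simp only [he_def]
    rw [Function.iterate_succ_apply']
  have hex : ∃ n, e n < 0 := exists_iterate_neg' β κ hκ1
  classical
  set N : ℕ := Nat.find hex with hN
  have hNneg : e N < 0 := Nat.find_spec hex
  have hbefore : ∀ k, k < N → 0 ≤ e k := fun k hk => not_lt.1 (Nat.find_min hex hk)
  -- while nonnegative, the exponents stay below `β`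
  have hmono : ∀ k, k ≤ N → e k ≤ β := by
    intro k
    induction k with
    | zero => intro; rw [he0]
    | succ k ih =>
      intro hk
      have hk' : k < N := Nat.lt_of_succ_le hk
      have h0 := hbefore k hk'
      have h1 := ih hk'.le
      rw [hesucc]
      nlinarith
  -- growth with exponent `e k` for every `k ≤ N`
  have hgrowth : ∀ k, k ≤ N → ∃ C : ℝ, 0 ≤ C ∧ ∀ R : ℝ, 1 ≤ R →
      ∫ y in ball (0 : EuclideanSpace ℝ (Fin 3)) R, ‖U y‖ ^ 2 ≤ C * R ^ (e k) := by
    intro k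
    induction k with
    | zero =>
      intro
      obtain ⟨C, hC0, hC⟩ := h.energyGrowth_of_memLp_of_window hp.le hαp hα2 hU hP hPoisson
      refine ⟨C, hC0, fun R hR => ?_⟩
      rw [he0, hβ]
      exact hC R hR
    | succ k ih =>
      intro hk
      have hk' : k < N := Nat.lt_of_succ_le hk
      obtain ⟨C, hC0, hC⟩ := ih hk'.le
      have h0 : 0 ≤ e k := hbefore k hk'
      have h1 : e k ≤ 3 - 6 / p := (hmono k hk'.le).trans hβ3
      have h1' : e k ≤ 3 - 2 * α := hmono k hk'.le
      obtain ⟨C', hC'0, hC'⟩ :=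
        h.energyGrowth_step_of_frequently_small hα hα2 hp hU hP hPoisson hsmall hC0 h0 h1 h1' hC
      refine ⟨C', hC'0, fun R hR => ?_⟩
      rw [hesucc]
      exact hC' R hR
  -- a negative growth exponent forces `U = 0`
  obtain ⟨C, -, hC⟩ := hgrowth N le_rfl
  have hα' : (3 : ℝ) / 2 < (3 - e N) / 2 := by linarith
  refine eq_zero_of_energyGrowth_of_three_halves_lt (L₀ := 1) (C := C) hα' hUc fun L hL => ?_
  rw [show 3 - 2 * ((3 - e N) / 2) = e N by ring]
  exact hC L hL

/-! ## BS15 Theorem 1.1 in the `L^p` class: the energy dichotomy -/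

/-- **Bronzi–Shvydkoy 2015, Theorem 1.1, lower bound, for `L^p` profiles (`3 < p < ∞`).** A
stationary self-similar Euler profile `(U, P)` with exponent `γ = 1/(α+1)`, `3/p < α ≤ 3/2`,
`U ∈ C² ∩ L^p(ℝ³)`, `P ∈ L^{p/2}(ℝ³)` (weak Poisson) is either trivial, or its ball energies are
bounded BELOW by the self-similar law: `c L^{3−2α} ≤ ∫_{|y|<L} |U|²` for all large `L`, some
`c > 0` ("either `v = 0` or one has `L^{N−2α} ≲ ∫_{|y|<L}|v(y)|² dy`"; the shell-growth hypothesis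
(1.7) of the printed theorem holds here with `γ = 0 < p − 2`).
[cite: BronziShvydkoy2015, §1 Thm. 1.1 (lower bound in (1.8))] -/
theorem IsSelfSimilarEulerProfile.energy_lower_bound_of_memLp {α p : ℝ}
    {U : EuclideanSpace ℝ (Fin 3) → EuclideanSpace ℝ (Fin 3)} {P : EuclideanSpace ℝ (Fin 3) → ℝ}
    (h : IsSelfSimilarEulerProfile (1 / (α + 1)) 0 U P) (hp : 3 < p) (hαp : 3 / p < α)
    (hα2 : α ≤ 3 / 2) (hU : MemLp U (ENNReal.ofReal p) volume)
    (hP : MemLp P (ENNReal.ofReal (p / 2)) volume)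
    (hPoisson : ∀ φ : EuclideanSpace ℝ (Fin 3) → ℝ, ContDiff ℝ (⊤ : ℕ∞) φ → HasCompactSupport φ →
      ∫ x, P x * (Δ φ) x = -∫ x, fderiv ℝ (fderiv ℝ φ) x (U x) (U x)) :
    U = 0 ∨ ∃ c L₀ : ℝ, 0 < c ∧ ∀ L : ℝ, L₀ ≤ L →
      c * L ^ (3 - 2 * α) ≤ ∫ y in ball (0 : EuclideanSpace ℝ (Fin 3)) L, ‖U y‖ ^ 2 := by
  by_cases hsmall : ∀ ε : ℝ, 0 < ε → ∀ M : ℝ, ∃ L : ℝ, M ≤ L ∧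
      L ^ (2 * α - 3) * ∫ y in ball (0 : EuclideanSpace ℝ (Fin 3)) L, ‖U y‖ ^ 2 ≤ ε
  · exact Or.inl (h.eq_zero_of_memLp_of_frequently_small hp hαp hα2 hU hP hPoisson hsmall)
  · right
    push Not at hsmall
    obtain ⟨ε, hε, M, hM⟩ := hsmall
    refine ⟨ε, max M 1, hε, fun L hL => ?_⟩
    have hL0 : 0 < L := lt_of_lt_of_le one_pos ((le_max_right _ _).trans hL)
    have hlt := hM L ((le_max_left _ _).trans hL)
    have hpos : 0 ≤ L ^ (3 - 2 * α) := Real.rpow_nonneg hL0.le _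
    have h1 := mul_le_mul_of_nonneg_right hlt.le hpos
    have h2 : L ^ (2 * α - 3) * (∫ y in ball (0 : EuclideanSpace ℝ (Fin 3)) L, ‖U y‖ ^ 2) *
        L ^ (3 - 2 * α) = ∫ y in ball (0 : EuclideanSpace ℝ (Fin 3)) L, ‖U y‖ ^ 2 := by
      rw [mul_comm (L ^ (2 * α - 3)), mul_assoc, ← Real.rpow_add hL0,
        show 2 * α - 3 + (3 - 2 * α) = 0 by ring, Real.rpow_zero, mul_one]
    rw [h2] at h1
    exact h1

/-- **Bronzi–Shvydkoy 2015, Theorem 1.1 for `L^p` profiles (`3 < p < ∞`): the energy dichotomy.**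
A stationary self-similar Euler profile with `3/p < α ≤ 3/2`, `U ∈ C² ∩ L^p(ℝ³)`, `P ∈ L^{p/2}(ℝ³)`
(weak Poisson) is either trivial or satisfies the TWO-SIDED self-similar energy law
`c L^{3−2α} ≤ ∫_{|y|<L} |U|² ≤ C L^{3−2α}` for all large `L` with `c > 0` — the conclusion shape of
`bronziShvydkoy2015_energy_dichotomy` ("either `v = 0` or `L^{N−2α} ≲ ∫_{|y|<L}|v|² ≲ L^{N−2α}`");
the upper bound is Chae–Shvydkoy's Corollary 3.4 (`energyGrowth_of_memLp_of_window`), which in the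
`L^p` class replaces the ambient finite energy ("the upper bound … is simply a consequence of the
fact that `v` is a part of the solution `u` with finite energy").
[cite: BronziShvydkoy2015, §1 Thm. 1.1 eq. (1.8); ChaeShvydkoy2013, §3.2.3 Cor. 3.4] -/
theorem IsSelfSimilarEulerProfile.energy_dichotomy_of_memLp {α p : ℝ}
    {U : EuclideanSpace ℝ (Fin 3) → EuclideanSpace ℝ (Fin 3)} {P : EuclideanSpace ℝ (Fin 3) → ℝ}
    (h : IsSelfSimilarEulerProfile (1 / (α + 1)) 0 U P) (hp : 3 < p) (hαp : 3 / p < α)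
    (hα2 : α ≤ 3 / 2) (hU : MemLp U (ENNReal.ofReal p) volume)
    (hP : MemLp P (ENNReal.ofReal (p / 2)) volume)
    (hPoisson : ∀ φ : EuclideanSpace ℝ (Fin 3) → ℝ, ContDiff ℝ (⊤ : ℕ∞) φ → HasCompactSupport φ →
      ∫ x, P x * (Δ φ) x = -∫ x, fderiv ℝ (fderiv ℝ φ) x (U x) (U x)) :
    U = 0 ∨ ∃ c C L₀ : ℝ, 0 < c ∧ ∀ L : ℝ, L₀ ≤ L →
      c * L ^ (3 - 2 * α) ≤ ∫ y in ball (0 : EuclideanSpace ℝ (Fin 3)) L, ‖U y‖ ^ 2 ∧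
        ∫ y in ball (0 : EuclideanSpace ℝ (Fin 3)) L, ‖U y‖ ^ 2 ≤ C * L ^ (3 - 2 * α) := by
  rcases h.energy_lower_bound_of_memLp hp hαp hα2 hU hP hPoisson with h0 | ⟨c, L₀, hc, hlow⟩
  · exact Or.inl h0
  · obtain ⟨C, -, hup⟩ := h.energyGrowth_of_memLp_of_window hp.le hαp hα2 hU hP hPoisson
    exact Or.inr ⟨c, C, max L₀ 1, hc, fun L hL =>
      ⟨hlow L ((le_max_left _ _).trans hL), hup L ((le_max_right _ _).trans hL)⟩⟩

/-! ## BS15 Remark 1.3: exclusion in the window from extra `L^p` decay on dyadic shells -/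

/-- **Hölder against `1`, general exponent** (copy of the private tool of
`SelfSimilarEulerLpTwoScale.lean`): for `1 < r`, `φ ≥ 0` with `φ ∈ L^r(S)` and `|S| < ∞`,
`∫_S φ ≤ (∫_S φ^r)^{1/r} |S|^{1 − 1/r}`. [folklore] -/
private theorem setIntegral_le_rpow_mul_measureReal_rpow' {r : ℝ} (hr : 1 < r)
    {φ : EuclideanSpace ℝ (Fin 3) → ℝ} {S : Set (EuclideanSpace ℝ (Fin 3))}
    (hS : volume S ≠ ⊤) (hφ0 : ∀ y, 0 ≤ φ y)
    (hφ : MemLp φ (ENNReal.ofReal r) (volume.restrict S)) :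
    ∫ y in S, φ y ≤ (∫ y in S, φ y ^ r) ^ (1 / r) * (volume.real S) ^ (1 - 1 / r) := by
  haveI : IsFiniteMeasure (volume.restrict S) := isFiniteMeasure_restrict.2 hS
  have hpq : Real.HolderConjugate r (Real.conjExponent r) := Real.HolderConjugate.conjExponent hr
  have h := integral_mul_le_Lp_mul_Lq_of_nonneg (μ := volume.restrict S) hpq
    (f := φ) (g := fun _ => (1 : ℝ))
    (Eventually.of_forall hφ0) (Eventually.of_forall fun _ => zero_le_one) hφ (memLp_const 1)
  have he : 1 / Real.conjExponent r = 1 - 1 / r := by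
    have h1 := hpq.inv_add_inv_eq_inv
    rw [inv_one] at h1
    rw [one_div, one_div]
    linarith
  simp only [mul_one, Real.one_rpow, integral_const, smul_eq_mul,
    measureReal_restrict_apply_univ, he] at h
  exact h

/-- **Hölder against `1` for `|U|²`, exponent `p/2`** (copy of the private tool of
`SelfSimilarEulerLpTwoScale.lean`): for `p > 2`, `U` continuous and `S` bounded,
`∫_S |U|² ≤ (∫_S |U|^p)^{2/p} |S|^{1 − 2/p}`. [folklore] -/
private theorem setIntegral_norm_sq_le_rpow_of_continuous' {p : ℝ} (hp : 2 < p)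
    {U : EuclideanSpace ℝ (Fin 3) → EuclideanSpace ℝ (Fin 3)} (hU : Continuous U)
    {S : Set (EuclideanSpace ℝ (Fin 3))} (hS : Bornology.IsBounded S) :
    ∫ y in S, ‖U y‖ ^ 2 ≤ (∫ y in S, ‖U y‖ ^ p) ^ (2 / p) * (volume.real S) ^ (1 - 2 / p) := by
  have hr : 1 < p / 2 := by
    rw [lt_div_iff₀ two_pos]
    linarith
  have hφ : MemLp (fun y => ‖U y‖ ^ 2) (ENNReal.ofReal (p / 2)) (volume.restrict S) :=
    memLp_restrict_of_continuous_isBounded (hU.norm.pow 2) hS _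
  have h := setIntegral_le_rpow_mul_measureReal_rpow' hr hS.measure_lt_top.ne
    (fun y => sq_nonneg _) hφ
  have e : ∀ y : EuclideanSpace ℝ (Fin 3), (‖U y‖ ^ 2) ^ (p / 2) = ‖U y‖ ^ p := fun y => by
    rw [← Real.rpow_natCast, ← Real.rpow_mul (norm_nonneg _)]
    congr 1
    push_cast
    ring
  have e1 : 1 / (p / 2) = 2 / p := by
    rw [one_div, inv_div]
  simp only [e, e1] at h
  exact h

/-- **The energy is frequently (indeed eventually) small under extra shell decay** (the Hölder
step of BS15 Remark 1.3: "if in addition `γ < N − pα` … then by the Hölder [inequality] one also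
has `∫_{|y|∼L}|v|² ≲ L^{N−2α} o(1)` … Consequently, since `α < N/2`, `∫_{|y|<L}|v|² ≲ L^{N−2α} o(1)`").
For a continuous field `U` on `ℝ³`, `p > 2`, `α < 3/2` and `γ < 3 − pα`: if
`∫_{L<|y|<2L} |U|^p ≤ C L^γ` for `L ≥ L₀`, then `L^{2α−3} ∫_{|y|<L} |U|² → 0`; in particular it is
frequently small. Proof: on the shell `{L < |y| < 2L}` Hölder gives
`∫|U|² ≤ (C L^γ)^{2/p} (8 v₁ L³)^{1−2/p} = C₂ L^{3 − 2(3−γ)/p}` with `3 − 2(3−γ)/p < 3 − 2α`;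
summing over dyadic shells (the spheres are Lebesgue-null) the ball energies are
`≤ A + B L^{s'}` with `s' < 3 − 2α`. [cite: BronziShvydkoy2015, §1 Rem. 1.3] -/
theorem energy_frequently_small_of_shellDecay {α p γ C L₀ : ℝ}
    {U : EuclideanSpace ℝ (Fin 3) → EuclideanSpace ℝ (Fin 3)} (hUc : Continuous U) (hp : 2 < p)
    (hα2 : α < 3 / 2) (hγ : γ < 3 - p * α)
    (hdecay : ∀ L : ℝ, L₀ ≤ L →
      ∫ y in {y : EuclideanSpace ℝ (Fin 3) | L < ‖y‖ ∧ ‖y‖ < 2 * L}, ‖U y‖ ^ p ≤ C * L ^ γ) :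
    ∀ ε : ℝ, 0 < ε → ∀ M : ℝ, ∃ L : ℝ, M ≤ L ∧
      L ^ (2 * α - 3) * ∫ y in ball (0 : EuclideanSpace ℝ (Fin 3)) L, ‖U y‖ ^ 2 ≤ ε := by
  have hp0 : 0 < p := by linarith
  -- scales
  set L₁ : ℝ := max L₀ 1 with hL₁_def
  have hL₁1 : 1 ≤ L₁ := le_max_right _ _
  have hL₁0 : 0 < L₁ := by linarith
  -- the constant `C` is nonnegative
  have hC : 0 ≤ C := by
    have h1 := hdecay L₁ (le_max_left _ _)
    have h0 : 0 ≤ ∫ y in {y : EuclideanSpace ℝ (Fin 3) | L₁ < ‖y‖ ∧ ‖y‖ < 2 * L₁}, ‖U y‖ ^ p :=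
      integral_nonneg fun y => by positivity
    have hLγ : 0 < L₁ ^ γ := Real.rpow_pos_of_pos hL₁0 _
    nlinarith
  -- exponents
  set s : ℝ := 3 - 2 * (3 - γ) / p with hs_def
  have hs : s < 3 - 2 * α := by
    rw [hs_def]
    have h1 : p * α < 3 - γ := by linarith
    have h2 : α < (3 - γ) / p := by rwa [lt_div_iff₀ hp0, mul_comm]
    have h3 : 2 * (3 - γ) / p = 2 * ((3 - γ) / p) := by ring
    linarith
  set s' : ℝ := max s ((3 - 2 * α) / 2) with hs'_def
  have hs'0 : 0 < s' := lt_of_lt_of_le (by linarith) (le_max_right _ _)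
  have hs'1 : s' < 3 - 2 * α := max_lt hs (by linarith)
  have hss' : s ≤ s' := le_max_left _ _
  -- unit-ball volume
  set v₁ : ℝ := (volume : Measure (EuclideanSpace ℝ (Fin 3))).real
    (closedBall (0 : EuclideanSpace ℝ (Fin 3)) 1) with hv₁_def
  have hv₁ : 0 ≤ v₁ := measureReal_nonneg
  set C₂ : ℝ := C ^ (2 / p) * (8 * v₁) ^ (1 - 2 / p) with hC₂_def
  have hC₂ : 0 ≤ C₂ := by positivity
  have h12 : 0 ≤ 1 - 2 / p := by
    rw [sub_nonneg, div_le_one hp0]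
    linarith
  -- integrability on balls
  have hint : ∀ R : ℝ, IntegrableOn (fun y => ‖U y‖ ^ 2) (ball (0 : EuclideanSpace ℝ (Fin 3)) R)
      volume := fun R =>
    ((hUc.norm.pow 2).continuousOn.integrableOn_compact (isCompact_closedBall 0 R)).mono_set
      ball_subset_closedBall
  set E : ℝ → ℝ := fun R => ∫ y in ball (0 : EuclideanSpace ℝ (Fin 3)) R, ‖U y‖ ^ 2 with hE_def
  have hE0 : ∀ R, 0 ≤ E R := fun R => integral_nonneg fun y => by positivity
  have hEmono : ∀ R R', R ≤ R' → E R ≤ E R' := fun R R' hRR' =>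
    setIntegral_mono_set (hint R') (ae_of_all _ fun y => by positivity)
      (ae_of_all _ (ball_subset_ball hRR'))
  -- Step 1: the shell energies (Hölder)
  have hshell : ∀ L : ℝ, L₁ ≤ L →
      ∫ y in {y : EuclideanSpace ℝ (Fin 3) | L < ‖y‖ ∧ ‖y‖ < 2 * L}, ‖U y‖ ^ 2 ≤ C₂ * L ^ s' := by
    intro L hL
    have hL1 : 1 ≤ L := hL₁1.trans hL
    have hL0 : 0 < L := by linarith
    set S : Set (EuclideanSpace ℝ (Fin 3)) := {y | L < ‖y‖ ∧ ‖y‖ < 2 * L} with hS_def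
    have hSsub : S ⊆ closedBall (0 : EuclideanSpace ℝ (Fin 3)) (2 * L) := fun y hy => by
      rw [mem_closedBall_zero_iff]
      exact hy.2.le
    have hSbdd : Bornology.IsBounded S := isBounded_closedBall.subset hSsub
    have hH := setIntegral_norm_sq_le_rpow_of_continuous' hp hUc hSbdd
    have hvolS : (volume : Measure (EuclideanSpace ℝ (Fin 3))).real S ≤ 8 * v₁ * L ^ 3 := by
      calc (volume : Measure (EuclideanSpace ℝ (Fin 3))).real S
          ≤ (volume : Measure (EuclideanSpace ℝ (Fin 3))).real
              (closedBall (0 : EuclideanSpace ℝ (Fin 3)) (2 * L)) :=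
            measureReal_mono hSsub measure_closedBall_lt_top.ne
        _ = 8 * v₁ * L ^ 3 := by
            rw [hv₁_def, Measure.addHaar_real_closedBall' volume (0 : EuclideanSpace ℝ (Fin 3))
              (by linarith : (0 : ℝ) ≤ 2 * L), finrank_euclideanSpace_fin]
            ring
    have hIp : (∫ y in S, ‖U y‖ ^ p) ^ (2 / p) ≤ C ^ (2 / p) * L ^ (γ * (2 / p)) := by
      have h1 : (∫ y in S, ‖U y‖ ^ p) ^ (2 / p) ≤ (C * L ^ γ) ^ (2 / p) :=
        Real.rpow_le_rpow (integral_nonneg fun y => by positivity) (hdecay L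
          ((le_max_left _ _).trans hL)) (by positivity)
      rw [Real.mul_rpow hC (Real.rpow_nonneg hL0.le _), ← Real.rpow_mul hL0.le] at h1
      exact h1
    have hVp : ((volume : Measure (EuclideanSpace ℝ (Fin 3))).real S) ^ (1 - 2 / p) ≤
        (8 * v₁) ^ (1 - 2 / p) * L ^ (3 * (1 - 2 / p)) := by
      have h1 := Real.rpow_le_rpow measureReal_nonneg hvolS h12
      rw [Real.mul_rpow (by positivity) (by positivity), ← Real.rpow_natCast L 3,
        ← Real.rpow_mul hL0.le] at h1
      exact_mod_cast h1
    have hLs : L ^ (γ * (2 / p)) * L ^ (3 * (1 - 2 / p)) = L ^ s := by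
      rw [← Real.rpow_add hL0, hs_def]
      congr 1
      field_simp
      ring
    have hLs' : L ^ s ≤ L ^ s' := Real.rpow_le_rpow_of_exponent_le hL1 hss'
    calc ∫ y in S, ‖U y‖ ^ 2
        ≤ (∫ y in S, ‖U y‖ ^ p) ^ (2 / p) *
            ((volume : Measure (EuclideanSpace ℝ (Fin 3))).real S) ^ (1 - 2 / p) := hH
      _ ≤ (C ^ (2 / p) * L ^ (γ * (2 / p))) * ((8 * v₁) ^ (1 - 2 / p) * L ^ (3 * (1 - 2 / p))) :=
          mul_le_mul hIp hVp (Real.rpow_nonneg measureReal_nonneg _) (by positivity)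
      _ = C₂ * (L ^ (γ * (2 / p)) * L ^ (3 * (1 - 2 / p))) := by rw [hC₂_def]; ring
      _ = C₂ * L ^ s := by rw [hLs]
      _ ≤ C₂ * L ^ s' := mul_le_mul_of_nonneg_left hLs' hC₂
  -- Step 2: one dyadic step `E(2L) ≤ E(L) + C₂ L^{s'}` (the sphere `|y| = L` is null)
  have hstep : ∀ L : ℝ, L₁ ≤ L → E (2 * L) ≤ E L + C₂ * L ^ s' := by
    intro L hL
    have hL0 : 0 < L := by linarith
    set T : Set (EuclideanSpace ℝ (Fin 3)) :=
      ball (0 : EuclideanSpace ℝ (Fin 3)) (2 * L) \ ball (0 : EuclideanSpace ℝ (Fin 3)) L with hT_def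
    have hTm : MeasurableSet T := measurableSet_ball.diff measurableSet_ball
    have hsub : ball (0 : EuclideanSpace ℝ (Fin 3)) L ⊆ ball (0 : EuclideanSpace ℝ (Fin 3)) (2 * L) :=
      ball_subset_ball (by linarith)
    have hunion : ball (0 : EuclideanSpace ℝ (Fin 3)) L ∪ T =
        ball (0 : EuclideanSpace ℝ (Fin 3)) (2 * L) := union_sdiff_cancel hsub
    have hdisj : Disjoint (ball (0 : EuclideanSpace ℝ (Fin 3)) L) T := disjoint_sdiff_right
    have hsplit : E (2 * L) = E L + ∫ y in T, ‖U y‖ ^ 2 := by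
      simp only [hE_def]
      rw [← hunion, setIntegral_union hdisj hTm (hint L) ((hint (2 * L)).mono_set sdiff_subset)]
    -- `T` and the open shell differ by a null sphere
    have hae : T =ᵐ[volume] {y : EuclideanSpace ℝ (Fin 3) | L < ‖y‖ ∧ ‖y‖ < 2 * L} := by
      rw [ae_eq_set]
      constructor
      · refine measure_mono_null (fun y hy => ?_)
          (Measure.addHaar_sphere volume (0 : EuclideanSpace ℝ (Fin 3)) L)
        obtain ⟨⟨h2, h1⟩, hnot⟩ := hy
        rw [mem_ball_zero_iff] at h2
        rw [mem_ball_zero_iff, not_lt] at h1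
        rw [mem_sphere_zero_iff_norm]
        simp only [mem_setOf_eq, not_and, not_lt] at hnot
        by_contra hne
        have hlt : L < ‖y‖ := lt_of_le_of_ne h1 (Ne.symm hne)
        linarith [hnot hlt]
      · refine measure_mono_null (fun y hy => ?_) (measure_empty (μ := volume))
        obtain ⟨⟨h1, h2⟩, hnot⟩ := hy
        exact hnot ⟨mem_ball_zero_iff.2 h2, fun h3 => by
          rw [mem_ball_zero_iff] at h3; linarith⟩
    rw [hsplit, setIntegral_congr_set hae]
    linarith [hshell L hL]
  -- Step 3: along the dyadic scales `2^n L₁`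
  set r : ℝ := (2 : ℝ) ^ s' with hr_def
  have hr1 : 1 < r := Real.one_lt_rpow (by norm_num) hs'0
  have hr0 : 0 < r := by linarith
  set C₃ : ℝ := C₂ * L₁ ^ s' / (r - 1) with hC₃_def
  have hC₃ : 0 ≤ C₃ := div_nonneg (by positivity) (by linarith)
  have hdyadic : ∀ n : ℕ, E (2 ^ n * L₁) ≤ E L₁ + C₃ * r ^ n := by
    intro n
    induction n with
    | zero =>
      have e0 : E (2 ^ 0 * L₁) = E L₁ := by simp
      rw [e0, pow_zero, mul_one]
      linarith [hC₃]
    | succ n ih =>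
      have hn : L₁ ≤ 2 ^ n * L₁ := le_mul_of_one_le_left hL₁0.le (one_le_pow₀ (by norm_num))
      have h1 := hstep (2 ^ n * L₁) hn
      rw [pow_succ, show (2 : ℝ) ^ n * 2 * L₁ = 2 * (2 ^ n * L₁) by ring]
      have hpow : (2 ^ n * L₁) ^ s' = r ^ n * L₁ ^ s' := by
        rw [Real.mul_rpow (by positivity) hL₁0.le, two_pow_rpow_comm s' n]
      have hgeom : C₃ * r ^ n + C₂ * (r ^ n * L₁ ^ s') ≤ C₃ * r ^ (n + 1) := by
        rw [hC₃_def, pow_succ]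
        have hr1' : 0 < r - 1 := by linarith
        rw [div_mul_eq_mul_div, div_mul_eq_mul_div, div_add' _ _ _ hr1'.ne',
          div_le_div_iff_of_pos_right hr1']
        nlinarith [pow_pos hr0 n, Real.rpow_nonneg hL₁0.le s', hC₂]
      calc E (2 * (2 ^ n * L₁)) ≤ E (2 ^ n * L₁) + C₂ * (2 ^ n * L₁) ^ s' := h1
        _ ≤ E L₁ + C₃ * r ^ n + C₂ * (r ^ n * L₁ ^ s') := by rw [hpow]; linarith
        _ ≤ E L₁ + C₃ * r ^ (n + 1) := by linarith
  -- Step 4: every `L ≥ L₁`: `E(L) ≤ E(L₁) + C₃ r (L/L₁)^{s'}`-type bound `A + B L^{s'}`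
  set B : ℝ := C₃ * r * L₁ ^ (-s') with hB_def
  have hB : 0 ≤ B := by positivity
  have hball : ∀ L : ℝ, L₁ ≤ L → E L ≤ E L₁ + B * L ^ s' := by
    intro L hL
    have hL0 : 0 < L := by linarith
    have hx : 1 ≤ L / L₁ := by rwa [le_div_iff₀ hL₁0, one_mul]
    obtain ⟨n, hn1, hn2⟩ := exists_nat_pow_near hx one_lt_two
    have hLn : L ≤ 2 ^ (n + 1) * L₁ := by
      have := (div_lt_iff₀ hL₁0).1 hn2
      linarith
    have h1 := (hEmono L (2 ^ (n + 1) * L₁) hLn).trans (hdyadic (n + 1))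
    -- `r^{n+1} = 2^{s'} (2^n)^{s'} ≤ r (L/L₁)^{s'}`
    have hrn : r ^ (n + 1) ≤ r * (L / L₁) ^ s' := by
      rw [pow_succ, mul_comm, hr_def, ← two_pow_rpow_comm s' n]
      exact mul_le_mul_of_nonneg_left (Real.rpow_le_rpow (by positivity) hn1 hs'0.le)
        (by positivity)
    have hdiv : (L / L₁) ^ s' = L ^ s' * L₁ ^ (-s') := by
      rw [Real.div_rpow hL0.le hL₁0.le, Real.rpow_neg hL₁0.le, div_eq_mul_inv]
    calc E L ≤ E L₁ + C₃ * r ^ (n + 1) := h1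
      _ ≤ E L₁ + C₃ * (r * (L / L₁) ^ s') := by gcongr
      _ = E L₁ + B * L ^ s' := by rw [hdiv, hB_def]; ring
  -- Step 5: the rescaled energy tends to zero
  have hlim : Tendsto (fun L : ℝ => E L₁ * L ^ (-(3 - 2 * α)) + B * L ^ (-(3 - 2 * α - s')))
      atTop (𝓝 0) := by
    have h1 := (tendsto_rpow_neg_atTop (by linarith : 0 < 3 - 2 * α)).const_mul (E L₁)
    have h2 := (tendsto_rpow_neg_atTop (by linarith : 0 < 3 - 2 * α - s')).const_mul B
    have := h1.add h2
    simpa using this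
  intro ε hε M
  have hev : ∀ᶠ L : ℝ in atTop,
      E L₁ * L ^ (-(3 - 2 * α)) + B * L ^ (-(3 - 2 * α - s')) < ε :=
    hlim.eventually (gt_mem_nhds hε)
  obtain ⟨L, hL, hLM⟩ := (hev.and (eventually_ge_atTop (max M L₁))).exists
  have hL₁L : L₁ ≤ L := (le_max_right _ _).trans hLM
  have hL0 : 0 < L := by linarith
  refine ⟨L, (le_max_left _ _).trans hLM, ?_⟩
  have h1 := hball L hL₁L
  have hpos : 0 ≤ L ^ (2 * α - 3) := Real.rpow_nonneg hL0.le _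
  have e1 : L ^ (2 * α - 3) = L ^ (-(3 - 2 * α)) := by
    congr 1
    ring
  have e2 : L ^ (2 * α - 3) * L ^ s' = L ^ (-(3 - 2 * α - s')) := by
    rw [← Real.rpow_add hL0]
    congr 1
    ring
  calc L ^ (2 * α - 3) * E L ≤ L ^ (2 * α - 3) * (E L₁ + B * L ^ s') :=
        mul_le_mul_of_nonneg_left h1 hpos
    _ = E L₁ * L ^ (-(3 - 2 * α)) + B * L ^ (-(3 - 2 * α - s')) := by
        rw [← e1, ← e2]
        ring
    _ ≤ ε := hL.le

/-- **Bronzi–Shvydkoy 2015, Remark 1.3 for `L^p` profiles: exclusion INSIDE the window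
`3/p < α < 3/2` from extra decay on shells.** A stationary self-similar Euler profile `(U, P)` with
exponent `γ = 1/(α+1)`, `3/p < α < 3/2` (`3 < p < ∞`), `U ∈ C² ∩ L^p(ℝ³)`, `P ∈ L^{p/2}(ℝ³)`
(weak Poisson), whose `L^p` mass on the dyadic shells decays faster than the natural rate,
`∫_{L<|y|<2L} |U|^p ≤ C L^γ'` for large `L` with `γ' < 3 − pα`, is trivial ("if in addition
`γ < N − pα` … invalidating the lower bound in (1.8). This implies `v = 0`. … in the range
`N/p < α < N/2`, Theorem 1.1 provides an extension of [Chae–Shvydkoy's] result by requesting an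
extra decay of the `L^p`-norms over the shells `{|y| ∼ L}`").
[cite: BronziShvydkoy2015, §1 Rem. 1.3] -/
theorem IsSelfSimilarEulerProfile.eq_zero_of_memLp_of_shellDecay {α p γ' C L₀ : ℝ}
    {U : EuclideanSpace ℝ (Fin 3) → EuclideanSpace ℝ (Fin 3)} {P : EuclideanSpace ℝ (Fin 3) → ℝ}
    (h : IsSelfSimilarEulerProfile (1 / (α + 1)) 0 U P) (hp : 3 < p) (hαp : 3 / p < α)
    (hα2 : α < 3 / 2) (hU : MemLp U (ENNReal.ofReal p) volume)
    (hP : MemLp P (ENNReal.ofReal (p / 2)) volume)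
    (hPoisson : ∀ φ : EuclideanSpace ℝ (Fin 3) → ℝ, ContDiff ℝ (⊤ : ℕ∞) φ → HasCompactSupport φ →
      ∫ x, P x * (Δ φ) x = -∫ x, fderiv ℝ (fderiv ℝ φ) x (U x) (U x))
    (hγ' : γ' < 3 - p * α)
    (hdecay : ∀ L : ℝ, L₀ ≤ L →
      ∫ y in {y : EuclideanSpace ℝ (Fin 3) | L < ‖y‖ ∧ ‖y‖ < 2 * L}, ‖U y‖ ^ p ≤ C * L ^ γ') :
    U = 0 :=
  h.eq_zero_of_memLp_of_frequently_small hp hαp hα2.le hU hP hPoisson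
    (energy_frequently_small_of_shellDecay h.contDiff_velocity.continuous (by linarith) hα2 hγ'
      hdecay)

/-! ## The case `p = 3` (`U ∈ L³`, `P ∈ L^{3/2}`): one round suffices -/

/-- The flux integrand `|U|³ + 2|P||U|` of an `L³` field with `L^{3/2}` pressure is integrable
(Hölder `3/2, 3`). [folklore] -/
private theorem integrable_flux_three {U : EuclideanSpace ℝ (Fin 3) → EuclideanSpace ℝ (Fin 3)}
    {P : EuclideanSpace ℝ (Fin 3) → ℝ} (hU3 : MemLp U 3 volume)
    (hP : MemLp P (3 / 2 : ℝ≥0∞) volume) :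
    Integrable (fun y => ‖U y‖ ^ 3 + 2 * (|P y| * ‖U y‖))
      (volume : Measure (EuclideanSpace ℝ (Fin 3))) := by
  have h1 : Integrable (fun y => ‖U y‖ ^ 3) (volume : Measure (EuclideanSpace ℝ (Fin 3))) := by
    have := hU3.integrable_norm_rpow (by norm_num) (by norm_num)
    refine this.congr (Eventually.of_forall fun y => ?_)
    simp only [ENNReal.toReal_ofNat]
    exact_mod_cast Real.rpow_natCast ‖U y‖ 3
  haveI : ENNReal.HolderTriple (3 / 2) 3 1 := by
    have h23 : (2 : ℝ≥0∞) / 3 + 3⁻¹ = 1 := by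
      rw [show (3 : ℝ≥0∞)⁻¹ = 1 / 3 by rw [one_div], ENNReal.div_add_div_same,
        show (2 : ℝ≥0∞) + 1 = 3 by norm_num]
      exact ENNReal.div_self (by norm_num) (by norm_num)
    constructor
    rw [ENNReal.inv_div (Or.inr (by norm_num)) (Or.inr (by norm_num)), inv_one, h23]
  have h2 : Integrable (fun y => |P y| * ‖U y‖) (volume : Measure (EuclideanSpace ℝ (Fin 3))) := by
    have := MemLp.integrable_mul hP.norm hU3.norm
    refine this.congr (Eventually.of_forall fun y => ?_)
    simp [Real.norm_eq_abs]
  exact h1.add (h2.const_mul 2)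

/-- **BS15 Theorem 1.1 at `p = 3`, contrapositive core.** A stationary self-similar Euler profile
with `−1 < α ≤ 3/2`, `U ∈ C² ∩ L³(ℝ³)`, `P ∈ L^{3/2}(ℝ³)`, whose rescaled ball energies are
frequently small, is trivial: the flux `|U|³ + 2|P||U|` is globally integrable, so the dyadic
flux sums at scale `l` are `≲ l^{2α−4}`, and one application of
`twoScaleEnergy_le_dyadicFlux_of_frequently_small` gives `∫_{|y|<R}|U|² ≲ R^{−1} → 0` (for
`α ≤ 1` this is already Chae–Shvydkoy's Theorem 3.2 at `p = 3` without the smallness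
hypothesis; the content is the window `1 < α ≤ 3/2`). [cite: BronziShvydkoy2015, §3 (proof of
Thm. 1.1); ChaeShvydkoy2013, §3.2 Thm. 3.2 (p = 3)] -/
theorem IsSelfSimilarEulerProfile.eq_zero_of_memLp_three_of_frequently_small {α : ℝ}
    {U : EuclideanSpace ℝ (Fin 3) → EuclideanSpace ℝ (Fin 3)} {P : EuclideanSpace ℝ (Fin 3) → ℝ}
    (h : IsSelfSimilarEulerProfile (1 / (α + 1)) 0 U P) (hα : -1 < α) (hα2 : α ≤ 3 / 2)
    (hU3 : MemLp U 3 volume) (hP : MemLp P (3 / 2 : ℝ≥0∞) volume)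
    (hsmall : ∀ ε : ℝ, 0 < ε → ∀ M : ℝ, ∃ L : ℝ, M ≤ L ∧
      L ^ (2 * α - 3) * ∫ y in ball (0 : EuclideanSpace ℝ (Fin 3)) L, ‖U y‖ ^ 2 ≤ ε) :
    U = 0 := by
  have hUc : Continuous U := h.contDiff_velocity.continuous
  set f : EuclideanSpace ℝ (Fin 3) → ℝ := fun y => ‖U y‖ ^ 3 + 2 * (|P y| * ‖U y‖) with hf_def
  have hf0 : ∀ y, 0 ≤ f y := fun y => by positivity
  have hfi : Integrable f (volume : Measure (EuclideanSpace ℝ (Fin 3))) :=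
    integrable_flux_three hU3 hP
  set F : ℝ := ∫ y, f y with hF_def
  have hF0 : 0 ≤ F := integral_nonneg hf0
  set e : ℝ := 2 * α - 4 with he_def
  have he : e < 0 := by rw [he_def]; linarith
  have hq0 : 0 ≤ (2 : ℝ) ^ e := by positivity
  have hq1 : (2 : ℝ) ^ e < 1 := Real.rpow_lt_one_of_one_lt_of_neg (by norm_num) he
  have hinv : 0 ≤ (1 - (2 : ℝ) ^ e)⁻¹ := inv_nonneg.2 (by linarith)
  obtain ⟨C_A, hCA0, hA⟩ := h.twoScaleEnergy_le_dyadicFlux_of_frequently_small hα hα2 hsmall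
  -- the dyadic flux sums at any scale `l > 0`
  have hB : ∀ l : ℝ, 0 < l → ∀ k : ℕ, ∑ j ∈ Finset.range k, (2 ^ j * l) ^ (2 * α - 4) *
      ∫ y in {y : EuclideanSpace ℝ (Fin 3) |
          (2 ^ j * l) ^ 2 / 2 ≤ ‖y‖ ^ 2 ∧ ‖y‖ ^ 2 ≤ 4 * (2 ^ j * l) ^ 2}, f y ≤
        F * (1 - (2 : ℝ) ^ e)⁻¹ * l ^ e := by
    intro l hl k
    have hterm : ∀ j : ℕ, (2 ^ j * l) ^ (2 * α - 4) *
        ∫ y in {y : EuclideanSpace ℝ (Fin 3) |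
            (2 ^ j * l) ^ 2 / 2 ≤ ‖y‖ ^ 2 ∧ ‖y‖ ^ 2 ≤ 4 * (2 ^ j * l) ^ 2}, f y ≤
          F * l ^ e * ((2 : ℝ) ^ e) ^ j := by
      intro j
      have hr : (0 : ℝ) < 2 ^ j * l := by positivity
      have hsh : ∫ y in {y : EuclideanSpace ℝ (Fin 3) |
          (2 ^ j * l) ^ 2 / 2 ≤ ‖y‖ ^ 2 ∧ ‖y‖ ^ 2 ≤ 4 * (2 ^ j * l) ^ 2}, f y ≤ F :=
        setIntegral_le_integral hfi (Eventually.of_forall hf0)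
      have hpow : (2 ^ j * l) ^ (2 * α - 4) = l ^ e * ((2 : ℝ) ^ e) ^ j := by
        rw [Real.mul_rpow (by positivity) hl.le, ← two_pow_rpow_comm e j, he_def]
        ring
      calc (2 ^ j * l) ^ (2 * α - 4) *
            ∫ y in {y : EuclideanSpace ℝ (Fin 3) |
              (2 ^ j * l) ^ 2 / 2 ≤ ‖y‖ ^ 2 ∧ ‖y‖ ^ 2 ≤ 4 * (2 ^ j * l) ^ 2}, f y
          ≤ (2 ^ j * l) ^ (2 * α - 4) * F :=
            mul_le_mul_of_nonneg_left hsh (Real.rpow_nonneg hr.le _)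
        _ = F * l ^ e * ((2 : ℝ) ^ e) ^ j := by rw [hpow]; ring
    calc ∑ j ∈ Finset.range k, (2 ^ j * l) ^ (2 * α - 4) *
          ∫ y in {y : EuclideanSpace ℝ (Fin 3) |
              (2 ^ j * l) ^ 2 / 2 ≤ ‖y‖ ^ 2 ∧ ‖y‖ ^ 2 ≤ 4 * (2 ^ j * l) ^ 2}, f y
        ≤ ∑ j ∈ Finset.range k, F * l ^ e * ((2 : ℝ) ^ e) ^ j :=
          Finset.sum_le_sum fun j _ => hterm j
      _ = F * l ^ e * ∑ j ∈ Finset.range k, ((2 : ℝ) ^ e) ^ j := by rw [Finset.mul_sum]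
      _ ≤ F * l ^ e * (1 - (2 : ℝ) ^ e)⁻¹ :=
          mul_le_mul_of_nonneg_left (geom_partial_sum_le hq0 hq1 k) (by positivity)
      _ = F * (1 - (2 : ℝ) ^ e)⁻¹ * l ^ e := by ring
  -- the energy growth with exponent `−1`
  have hgrowth : ∀ R : ℝ, 1 ≤ R →
      ∫ y in ball (0 : EuclideanSpace ℝ (Fin 3)) R, ‖U y‖ ^ 2 ≤
        C_A * (F * (1 - (2 : ℝ) ^ e)⁻¹) * 2 ^ (-1 : ℝ) * R ^ (3 - 2 * (2 : ℝ)) := by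
    intro R hR
    have hR0 : 0 < R := by linarith
    set l : ℝ := 2 * R with hl_def
    have hl0 : 0 < l := by positivity
    have hmain := hA l hl0 _ (hB l hl0)
    rw [show l / 2 = R by rw [hl_def]; ring] at hmain
    have hlpow : 0 < l ^ (2 * α - 3) := Real.rpow_pos_of_pos hl0 _
    have hdiv : ∫ y in ball (0 : EuclideanSpace ℝ (Fin 3)) R, ‖U y‖ ^ 2 ≤
        C_A * (F * (1 - (2 : ℝ) ^ e)⁻¹ * l ^ e) / l ^ (2 * α - 3) := by
      rw [le_div_iff₀ hlpow, mul_comm]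
      exact hmain
    have hexp : l ^ e / l ^ (2 * α - 3) = 2 ^ (-1 : ℝ) * R ^ (3 - 2 * (2 : ℝ)) := by
      rw [← Real.rpow_sub hl0, show e - (2 * α - 3) = -1 by rw [he_def]; ring, hl_def,
        Real.mul_rpow (by norm_num) hR0.le]
      norm_num
    calc ∫ y in ball (0 : EuclideanSpace ℝ (Fin 3)) R, ‖U y‖ ^ 2
        ≤ C_A * (F * (1 - (2 : ℝ) ^ e)⁻¹ * l ^ e) / l ^ (2 * α - 3) := hdiv
      _ = C_A * (F * (1 - (2 : ℝ) ^ e)⁻¹) * (l ^ e / l ^ (2 * α - 3)) := by ring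
      _ = C_A * (F * (1 - (2 : ℝ) ^ e)⁻¹) * 2 ^ (-1 : ℝ) * R ^ (3 - 2 * (2 : ℝ)) := by
          rw [hexp]; ring
  exact eq_zero_of_energyGrowth_of_three_halves_lt (by norm_num : (3 : ℝ) / 2 < 2) hUc hgrowth

/-- **BS15 Theorem 1.1 at `p = 3`: the energy dichotomy in the window `1 < α ≤ 3/2`.** A
stationary self-similar Euler profile with `1 < α ≤ 3/2`, `U ∈ C² ∩ L³(ℝ³)`, `P ∈ L^{3/2}(ℝ³)` is
either trivial or satisfies `c L^{3−2α} ≤ ∫_{|y|<L} |U|² ≤ C L^{3−2α}` for all large `L`, `c > 0`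
(the upper bound is Chae–Shvydkoy's Corollary 3.4 at `p = 3`).
[cite: BronziShvydkoy2015, §1 Thm. 1.1 eq. (1.8); ChaeShvydkoy2013, §3.2.3 Cor. 3.4] -/
theorem IsSelfSimilarEulerProfile.energy_dichotomy_of_memLp_three {α : ℝ}
    {U : EuclideanSpace ℝ (Fin 3) → EuclideanSpace ℝ (Fin 3)} {P : EuclideanSpace ℝ (Fin 3) → ℝ}
    (h : IsSelfSimilarEulerProfile (1 / (α + 1)) 0 U P) (hα1 : 1 < α) (hα2 : α ≤ 3 / 2)
    (hU3 : MemLp U 3 volume) (hP : MemLp P (3 / 2 : ℝ≥0∞) volume) :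
    U = 0 ∨ ∃ c C L₀ : ℝ, 0 < c ∧ ∀ L : ℝ, L₀ ≤ L →
      c * L ^ (3 - 2 * α) ≤ ∫ y in ball (0 : EuclideanSpace ℝ (Fin 3)) L, ‖U y‖ ^ 2 ∧
        ∫ y in ball (0 : EuclideanSpace ℝ (Fin 3)) L, ‖U y‖ ^ 2 ≤ C * L ^ (3 - 2 * α) := by
  have hα : -1 < α := by linarith
  by_cases hsmall : ∀ ε : ℝ, 0 < ε → ∀ M : ℝ, ∃ L : ℝ, M ≤ L ∧
      L ^ (2 * α - 3) * ∫ y in ball (0 : EuclideanSpace ℝ (Fin 3)) L, ‖U y‖ ^ 2 ≤ ε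
  · exact Or.inl (h.eq_zero_of_memLp_three_of_frequently_small hα hα2 hU3 hP hsmall)
  · right
    push Not at hsmall
    obtain ⟨ε, hε, M, hM⟩ := hsmall
    -- the upper bound: Cor. 3.4 at `p = 3`
    have hU' : MemLp U (ENNReal.ofReal 3) volume := by
      rwa [show ENNReal.ofReal 3 = 3 by norm_num]
    have hP' : MemLp P (ENNReal.ofReal (3 / 2)) volume := by
      rwa [ENNReal.ofReal_div_of_pos two_pos, show ENNReal.ofReal 3 = 3 by norm_num,
        ENNReal.ofReal_ofNat]
    obtain ⟨C, -, hup⟩ := h.energyGrowth_of_memLp_of_window' le_rfl (by norm_num; linarith)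
      hα2 hU' hP'
    refine ⟨ε, C, max M 1, hε, fun L hL => ⟨?_, hup L ((le_max_right _ _).trans hL)⟩⟩
    have hL0 : 0 < L := lt_of_lt_of_le one_pos ((le_max_right _ _).trans hL)
    have hlt := hM L ((le_max_left _ _).trans hL)
    have hpos : 0 ≤ L ^ (3 - 2 * α) := Real.rpow_nonneg hL0.le _
    have h1 := mul_le_mul_of_nonneg_right hlt.le hpos
    have h2 : L ^ (2 * α - 3) * (∫ y in ball (0 : EuclideanSpace ℝ (Fin 3)) L, ‖U y‖ ^ 2) *
        L ^ (3 - 2 * α) = ∫ y in ball (0 : EuclideanSpace ℝ (Fin 3)) L, ‖U y‖ ^ 2 := by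
      rw [mul_comm (L ^ (2 * α - 3)), mul_assoc, ← Real.rpow_add hL0,
        show 2 * α - 3 + (3 - 2 * α) = 0 by ring, Real.rpow_zero, mul_one]
    rw [h2] at h1
    exact h1

/-! ## Versions without the weak-Poisson hypothesis and in the binder shape of the facts -/

/-- **BS15 Theorem 1.1 for `L^p` profiles, hypotheses: profile, `U ∈ L^p`, `P ∈ L^{p/2}`** (the
weak Poisson equation is automatic for `C²` profiles, `IsSelfSimilarEulerProfile.weakPoisson`).
[cite: BronziShvydkoy2015, §1 Thm. 1.1 eq. (1.8)] -/
theorem IsSelfSimilarEulerProfile.energy_dichotomy_of_memLp' {α p : ℝ}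
    {U : EuclideanSpace ℝ (Fin 3) → EuclideanSpace ℝ (Fin 3)} {P : EuclideanSpace ℝ (Fin 3) → ℝ}
    (h : IsSelfSimilarEulerProfile (1 / (α + 1)) 0 U P) (hp : 3 < p) (hαp : 3 / p < α)
    (hα2 : α ≤ 3 / 2) (hU : MemLp U (ENNReal.ofReal p) volume)
    (hP : MemLp P (ENNReal.ofReal (p / 2)) volume) :
    U = 0 ∨ ∃ c C L₀ : ℝ, 0 < c ∧ ∀ L : ℝ, L₀ ≤ L →
      c * L ^ (3 - 2 * α) ≤ ∫ y in ball (0 : EuclideanSpace ℝ (Fin 3)) L, ‖U y‖ ^ 2 ∧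
        ∫ y in ball (0 : EuclideanSpace ℝ (Fin 3)) L, ‖U y‖ ^ 2 ≤ C * L ^ (3 - 2 * α) :=
  h.energy_dichotomy_of_memLp hp hαp hα2 hU hP fun _ hφ hφc => h.weakPoisson hφ hφc

/-- **BS15 Remark 1.3 for `L^p` profiles, hypotheses: profile, `U ∈ L^p`, `P ∈ L^{p/2}`, shell
decay.** [cite: BronziShvydkoy2015, §1 Rem. 1.3] -/
theorem IsSelfSimilarEulerProfile.eq_zero_of_memLp_of_shellDecay' {α p γ' C L₀ : ℝ}
    {U : EuclideanSpace ℝ (Fin 3) → EuclideanSpace ℝ (Fin 3)} {P : EuclideanSpace ℝ (Fin 3) → ℝ}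
    (h : IsSelfSimilarEulerProfile (1 / (α + 1)) 0 U P) (hp : 3 < p) (hαp : 3 / p < α)
    (hα2 : α < 3 / 2) (hU : MemLp U (ENNReal.ofReal p) volume)
    (hP : MemLp P (ENNReal.ofReal (p / 2)) volume) (hγ' : γ' < 3 - p * α)
    (hdecay : ∀ L : ℝ, L₀ ≤ L →
      ∫ y in {y : EuclideanSpace ℝ (Fin 3) | L < ‖y‖ ∧ ‖y‖ < 2 * L}, ‖U y‖ ^ p ≤ C * L ^ γ') :
    U = 0 :=
  h.eq_zero_of_memLp_of_shellDecay hp hαp hα2 hU hP (fun _ hφ hφc => h.weakPoisson hφ hφc)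
    hγ' hdecay

/-- **Bronzi–Shvydkoy 2015, Theorem 1.1, `L^p` class, every `3 ≤ p < ∞`** (binder shape of the
Chae–Shvydkoy facts: `p : ℝ≥0∞`, `3 ≤ p`, `p ≠ ∞`, `U ∈ L^p`, `P ∈ L^{p/2}`): in the window
`3/p < α ≤ 3/2` a stationary self-similar Euler profile is trivial or obeys the two-sided energy
law `c L^{3−2α} ≤ ∫_{|y|<L}|U|² ≤ C L^{3−2α}` for large `L`.
[cite: BronziShvydkoy2015, §1 Thm. 1.1 eq. (1.8); ChaeShvydkoy2013, §3.2.3 Cor. 3.4] -/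
theorem bronziShvydkoy2015_dichotomy_of_memLp (α : ℝ) (p : ℝ≥0∞)
    (U : EuclideanSpace ℝ (Fin 3) → EuclideanSpace ℝ (Fin 3)) (P : EuclideanSpace ℝ (Fin 3) → ℝ)
    (h3 : 3 ≤ p) (htop : p ≠ ∞) (hαp : 3 / p.toReal < α) (hα2 : α ≤ 3 / 2)
    (hprof : IsSelfSimilarEulerProfile (1 / (α + 1)) 0 U P)
    (hU : MemLp U p volume) (hP : MemLp P (p / 2) volume) :
    U = 0 ∨ ∃ c C L₀ : ℝ, 0 < c ∧ ∀ L : ℝ, L₀ ≤ L →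
      c * L ^ (3 - 2 * α) ≤ ∫ y in ball (0 : EuclideanSpace ℝ (Fin 3)) L, ‖U y‖ ^ 2 ∧
        ∫ y in ball (0 : EuclideanSpace ℝ (Fin 3)) L, ‖U y‖ ^ 2 ≤ C * L ^ (3 - 2 * α) := by
  rcases eq_or_lt_of_le h3 with h3eq | h3lt
  · -- `p = 3`
    subst h3eq
    have hα1 : 1 < α := by
      have e : (3 : ℝ) / (3 : ℝ≥0∞).toReal = 1 := by norm_num
      rwa [e] at hαp
    have hP' : MemLp P (3 / 2 : ℝ≥0∞) volume := hP
    exact hprof.energy_dichotomy_of_memLp_three hα1 hα2 hU hP'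
  · -- `3 < p < ∞`
    have hpr : 3 < p.toReal := by
      have := (ENNReal.toReal_lt_toReal (by norm_num : (3 : ℝ≥0∞) ≠ ⊤) htop).2 h3lt
      simpa using this
    have hU' : MemLp U (ENNReal.ofReal p.toReal) volume := by rwa [ENNReal.ofReal_toReal htop]
    have hP' : MemLp P (ENNReal.ofReal (p.toReal / 2)) volume := by
      rw [ENNReal.ofReal_div_of_pos two_pos, ENNReal.ofReal_toReal htop]
      simpa using hP
    exact hprof.energy_dichotomy_of_memLp' hpr hαp hα2 hU' hP'

/-- **Bronzi–Shvydkoy 2015, Remark 1.3, `L^p` class, every `3 ≤ p < ∞`** (binder shape of the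
Chae–Shvydkoy facts): in the window `3/p < α < 3/2`, an `L^p` shell mass decaying faster than the
natural rate, `∫_{L<|y|<2L}|U|^p ≤ C L^γ'` with `γ' < 3 − pα`, forces `U = 0`.
[cite: BronziShvydkoy2015, §1 Rem. 1.3] -/
theorem bronziShvydkoy2015_exclusion_of_shellDecay (α : ℝ) (p : ℝ≥0∞)
    (U : EuclideanSpace ℝ (Fin 3) → EuclideanSpace ℝ (Fin 3)) (P : EuclideanSpace ℝ (Fin 3) → ℝ)
    (h3 : 3 ≤ p) (htop : p ≠ ∞) (hαp : 3 / p.toReal < α) (hα2 : α < 3 / 2)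
    (hprof : IsSelfSimilarEulerProfile (1 / (α + 1)) 0 U P)
    (hU : MemLp U p volume) (hP : MemLp P (p / 2) volume) {γ' C L₀ : ℝ}
    (hγ' : γ' < 3 - p.toReal * α)
    (hdecay : ∀ L : ℝ, L₀ ≤ L →
      ∫ y in {y : EuclideanSpace ℝ (Fin 3) | L < ‖y‖ ∧ ‖y‖ < 2 * L}, ‖U y‖ ^ p.toReal ≤
        C * L ^ γ') :
    U = 0 := by
  have hUc : Continuous U := hprof.contDiff_velocity.continuous
  rcases eq_or_lt_of_le h3 with h3eq | h3lt
  · -- `p = 3`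
    subst h3eq
    have e3 : (3 : ℝ≥0∞).toReal = 3 := by norm_num
    rw [e3] at hαp hγ' hdecay
    have hα : -1 < α := by linarith
    have hP' : MemLp P (3 / 2 : ℝ≥0∞) volume := hP
    exact hprof.eq_zero_of_memLp_three_of_frequently_small hα hα2.le hU hP'
      (energy_frequently_small_of_shellDecay hUc (by norm_num) hα2 hγ' hdecay)
  · -- `3 < p < ∞`
    have hpr : 3 < p.toReal := by
      have := (ENNReal.toReal_lt_toReal (by norm_num : (3 : ℝ≥0∞) ≠ ⊤) htop).2 h3lt
      simpa using this
    have hU' : MemLp U (ENNReal.ofReal p.toReal) volume := by rwa [ENNReal.ofReal_toReal htop]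
    have hP' : MemLp P (ENNReal.ofReal (p.toReal / 2)) volume := by
      rw [ENNReal.ofReal_div_of_pos two_pos, ENNReal.ofReal_toReal htop]
      simpa using hP
    exact hprof.eq_zero_of_memLp_of_shellDecay' hpr hαp hα2 hU' hP' hγ' hdecay

/-! ## BS15 Remark 1.4 in kernel form: decay faster than the natural rate `|y|^{−α}` forces
`U = 0` -/

/-- **Dyadic summation of small shell energies.** For a continuous field `U` on `ℝ³`, `α < 3/2`,
`L₁ > 0`: if `∫_{L<|y|<2L} |U|² ≤ δ L^{3−2α}` for all `L ≥ L₁` (`δ ≥ 0`), then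
`∫_{|y|<L} |U|² ≤ ∫_{|y|<L₁} |U|² + K δ L^{3−2α}` for all `L ≥ L₁`, with
`K = 2^{3−2α}/(2^{3−2α} − 1)` (the spheres are Lebesgue-null; geometric sum with ratio
`2^{3−2α} > 1`). This is the summation "since `α < N/2`, `∫_{|y|<L}|v|² ≲ L^{N−2α} o(1)`" of
BS15 Remark 1.3. [cite: BronziShvydkoy2015, §1 Rem. 1.3] -/
theorem ball_energy_le_of_shellEnergy_le {α δ L₁ : ℝ}
    {U : EuclideanSpace ℝ (Fin 3) → EuclideanSpace ℝ (Fin 3)} (hUc : Continuous U)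
    (hα2 : α < 3 / 2) (hL₁ : 0 < L₁) (hδ : 0 ≤ δ)
    (hshell : ∀ L : ℝ, L₁ ≤ L →
      ∫ y in {y : EuclideanSpace ℝ (Fin 3) | L < ‖y‖ ∧ ‖y‖ < 2 * L}, ‖U y‖ ^ 2 ≤
        δ * L ^ (3 - 2 * α)) :
    ∀ L : ℝ, L₁ ≤ L →
      ∫ y in ball (0 : EuclideanSpace ℝ (Fin 3)) L, ‖U y‖ ^ 2 ≤
        (∫ y in ball (0 : EuclideanSpace ℝ (Fin 3)) L₁, ‖U y‖ ^ 2) +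
          (2 : ℝ) ^ (3 - 2 * α) / ((2 : ℝ) ^ (3 - 2 * α) - 1) * δ * L ^ (3 - 2 * α) := by
  set e : ℝ := 3 - 2 * α with he_def
  have he : 0 < e := by rw [he_def]; linarith
  -- integrability on balls and monotonicity of the ball energy
  have hint : ∀ R : ℝ, IntegrableOn (fun y => ‖U y‖ ^ 2) (ball (0 : EuclideanSpace ℝ (Fin 3)) R)
      volume := fun R =>
    ((hUc.norm.pow 2).continuousOn.integrableOn_compact (isCompact_closedBall 0 R)).mono_set
      ball_subset_closedBall
  set E : ℝ → ℝ := fun R => ∫ y in ball (0 : EuclideanSpace ℝ (Fin 3)) R, ‖U y‖ ^ 2 with hE_def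
  have hEmono : ∀ R R', R ≤ R' → E R ≤ E R' := fun R R' hRR' =>
    setIntegral_mono_set (hint R') (ae_of_all _ fun y => by positivity)
      (ae_of_all _ (ball_subset_ball hRR'))
  -- one dyadic step `E(2L) ≤ E(L) + δ L^e` (the sphere `|y| = L` is null)
  have hstep : ∀ L : ℝ, L₁ ≤ L → E (2 * L) ≤ E L + δ * L ^ e := by
    intro L hL
    have hL0 : 0 < L := by linarith
    set T : Set (EuclideanSpace ℝ (Fin 3)) :=
      ball (0 : EuclideanSpace ℝ (Fin 3)) (2 * L) \ ball (0 : EuclideanSpace ℝ (Fin 3)) L with hT_def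
    have hTm : MeasurableSet T := measurableSet_ball.diff measurableSet_ball
    have hsub : ball (0 : EuclideanSpace ℝ (Fin 3)) L ⊆ ball (0 : EuclideanSpace ℝ (Fin 3)) (2 * L) :=
      ball_subset_ball (by linarith)
    have hunion : ball (0 : EuclideanSpace ℝ (Fin 3)) L ∪ T =
        ball (0 : EuclideanSpace ℝ (Fin 3)) (2 * L) := union_sdiff_cancel hsub
    have hdisj : Disjoint (ball (0 : EuclideanSpace ℝ (Fin 3)) L) T := disjoint_sdiff_right
    have hsplit : E (2 * L) = E L + ∫ y in T, ‖U y‖ ^ 2 := by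
      simp only [hE_def]
      rw [← hunion, setIntegral_union hdisj hTm (hint L) ((hint (2 * L)).mono_set sdiff_subset)]
    have hae : T =ᵐ[volume] {y : EuclideanSpace ℝ (Fin 3) | L < ‖y‖ ∧ ‖y‖ < 2 * L} := by
      rw [ae_eq_set]
      constructor
      · refine measure_mono_null (fun y hy => ?_)
          (Measure.addHaar_sphere volume (0 : EuclideanSpace ℝ (Fin 3)) L)
        obtain ⟨⟨h2, h1⟩, hnot⟩ := hy
        rw [mem_ball_zero_iff] at h2
        rw [mem_ball_zero_iff, not_lt] at h1
        rw [mem_sphere_zero_iff_norm]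
        simp only [mem_setOf_eq, not_and, not_lt] at hnot
        by_contra hne
        have hlt : L < ‖y‖ := lt_of_le_of_ne h1 (Ne.symm hne)
        linarith [hnot hlt]
      · refine measure_mono_null (fun y hy => ?_) (measure_empty (μ := volume))
        obtain ⟨⟨h1, h2⟩, hnot⟩ := hy
        exact hnot ⟨mem_ball_zero_iff.2 h2, fun h3 => by
          rw [mem_ball_zero_iff] at h3; linarith⟩
    rw [hsplit, setIntegral_congr_set hae]
    linarith [hshell L hL]
  -- along the dyadic scales `2^n L₁`
  set r : ℝ := (2 : ℝ) ^ e with hr_def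
  have hr1 : 1 < r := Real.one_lt_rpow (by norm_num) he
  have hr0 : 0 < r := by linarith
  have hr1' : 0 < r - 1 := by linarith
  set C₃ : ℝ := δ * L₁ ^ e / (r - 1) with hC₃_def
  have hC₃ : 0 ≤ C₃ := div_nonneg (by positivity) hr1'.le
  have hdyadic : ∀ n : ℕ, E (2 ^ n * L₁) ≤ E L₁ + C₃ * r ^ n := by
    intro n
    induction n with
    | zero =>
      have e0 : E (2 ^ 0 * L₁) = E L₁ := by simp
      rw [e0, pow_zero, mul_one]
      linarith [hC₃]
    | succ n ih =>
      have hn : L₁ ≤ 2 ^ n * L₁ := le_mul_of_one_le_left hL₁.le (one_le_pow₀ (by norm_num))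
      have h1 := hstep (2 ^ n * L₁) hn
      rw [pow_succ, show (2 : ℝ) ^ n * 2 * L₁ = 2 * (2 ^ n * L₁) by ring]
      have hpow : (2 ^ n * L₁) ^ e = r ^ n * L₁ ^ e := by
        rw [Real.mul_rpow (by positivity) hL₁.le, two_pow_rpow_comm e n]
      have hgeom : C₃ * r ^ n + δ * (r ^ n * L₁ ^ e) ≤ C₃ * r ^ (n + 1) := by
        rw [hC₃_def, pow_succ]
        rw [div_mul_eq_mul_div, div_mul_eq_mul_div, div_add' _ _ _ hr1'.ne',
          div_le_div_iff_of_pos_right hr1']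
        nlinarith [pow_pos hr0 n, Real.rpow_nonneg hL₁.le e, hδ]
      calc E (2 * (2 ^ n * L₁)) ≤ E (2 ^ n * L₁) + δ * (2 ^ n * L₁) ^ e := h1
        _ ≤ E L₁ + C₃ * r ^ n + δ * (r ^ n * L₁ ^ e) := by rw [hpow]; linarith
        _ ≤ E L₁ + C₃ * r ^ (n + 1) := by linarith
  -- every `L ≥ L₁`
  intro L hL
  have hL0 : 0 < L := by linarith
  have hx : 1 ≤ L / L₁ := by rwa [le_div_iff₀ hL₁, one_mul]
  obtain ⟨n, hn1, hn2⟩ := exists_nat_pow_near hx one_lt_two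
  have hLn : L ≤ 2 ^ (n + 1) * L₁ := by
    have := (div_lt_iff₀ hL₁).1 hn2
    linarith
  have h1 := (hEmono L (2 ^ (n + 1) * L₁) hLn).trans (hdyadic (n + 1))
  have hrn : r ^ (n + 1) ≤ r * (L / L₁) ^ e := by
    rw [pow_succ, mul_comm, hr_def, ← two_pow_rpow_comm e n]
    exact mul_le_mul_of_nonneg_left (Real.rpow_le_rpow (by positivity) hn1 he.le)
      (by positivity)
  have hdiv : (L / L₁) ^ e = L ^ e * L₁ ^ (-e) := by
    rw [Real.div_rpow hL0.le hL₁.le, Real.rpow_neg hL₁.le, div_eq_mul_inv]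
  have hLL : L₁ ^ e * L₁ ^ (-e) = 1 := by
    rw [← Real.rpow_add hL₁, add_neg_cancel, Real.rpow_zero]
  calc E L ≤ E L₁ + C₃ * r ^ (n + 1) := h1
    _ ≤ E L₁ + C₃ * (r * (L / L₁) ^ e) := by gcongr
    _ = E L₁ + r / (r - 1) * δ * L ^ e * (L₁ ^ e * L₁ ^ (-e)) := by
        rw [hdiv, hC₃_def]
        field_simp
    _ = E L₁ + r / (r - 1) * δ * L ^ e := by rw [hLL, mul_one]

/-- **Pointwise decay faster than `|y|^{−α}` makes the rescaled energy tend to zero.** For a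
continuous field `U` on `ℝ³` and `0 ≤ α < 3/2`: if `|y|^α |U(y)| → 0` as `|y| → ∞`, then
`L^{2α−3} ∫_{|y|<L} |U|² → 0` (shell energies `≤ 8 v₁ η² L^{3−2α}` beyond the decay radius, then
`ball_energy_le_of_shellEnergy_le`). [cite: BronziShvydkoy2015, §1 Rems. 1.3–1.4] -/
theorem energy_eventually_small_of_decay {α : ℝ}
    {U : EuclideanSpace ℝ (Fin 3) → EuclideanSpace ℝ (Fin 3)} (hUc : Continuous U)
    (hα0 : 0 ≤ α) (hα2 : α < 3 / 2)
    (hdecay : ∀ η : ℝ, 0 < η → ∃ R : ℝ, ∀ y : EuclideanSpace ℝ (Fin 3), R ≤ ‖y‖ →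
      ‖y‖ ^ α * ‖U y‖ ≤ η) :
    ∀ ε : ℝ, 0 < ε → ∃ M : ℝ, ∀ L : ℝ, M ≤ L →
      L ^ (2 * α - 3) * ∫ y in ball (0 : EuclideanSpace ℝ (Fin 3)) L, ‖U y‖ ^ 2 ≤ ε := by
  intro ε hε
  set e : ℝ := 3 - 2 * α with he_def
  have he : 0 < e := by rw [he_def]; linarith
  set r : ℝ := (2 : ℝ) ^ e with hr_def
  have hr1 : 1 < r := Real.one_lt_rpow (by norm_num) he
  set K : ℝ := r / (r - 1) with hK_def
  have hK : 0 ≤ K := div_nonneg (by linarith) (by linarith)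
  set v₁ : ℝ := (volume : Measure (EuclideanSpace ℝ (Fin 3))).real
    (closedBall (0 : EuclideanSpace ℝ (Fin 3)) 1) with hv₁_def
  have hv₁ : 0 ≤ v₁ := measureReal_nonneg
  -- the smallness parameter `η ≤ 1` with `K · 8 v₁ · η ≤ ε/2`
  set η : ℝ := min 1 (ε / (2 * (8 * v₁ * K + 1))) with hη_def
  have hη0 : 0 < η := lt_min one_pos (by positivity)
  have hη1 : η ≤ 1 := min_le_left _ _
  have hηε : K * (8 * v₁ * η ^ 2) ≤ ε / 2 := by
    have h1 : η ^ 2 ≤ η := by nlinarith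
    have h2 : η ≤ ε / (2 * (8 * v₁ * K + 1)) := min_le_right _ _
    have h3 : 8 * v₁ * K * η ≤ ε / 2 := by
      have h4 : 8 * v₁ * K * η ≤ 8 * v₁ * K * (ε / (2 * (8 * v₁ * K + 1))) :=
        mul_le_mul_of_nonneg_left h2 (by positivity)
      have h5 : 8 * v₁ * K * (ε / (2 * (8 * v₁ * K + 1))) ≤ ε / 2 := by
        rw [mul_div_assoc', div_le_div_iff₀ (by positivity) two_pos]
        nlinarith [mul_nonneg (mul_nonneg (by norm_num : (0 : ℝ) ≤ 8) hv₁) hK, hε.le]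
      linarith
    calc K * (8 * v₁ * η ^ 2) ≤ K * (8 * v₁ * η) := by gcongr
      _ = 8 * v₁ * K * η := by ring
      _ ≤ ε / 2 := h3
  obtain ⟨R, hR⟩ := hdecay η hη0
  set L₁ : ℝ := max R 1 with hL₁_def
  have hL₁0 : 0 < L₁ := lt_of_lt_of_le one_pos (le_max_right _ _)
  -- shell energies beyond `L₁`
  have hshell : ∀ L : ℝ, L₁ ≤ L →
      ∫ y in {y : EuclideanSpace ℝ (Fin 3) | L < ‖y‖ ∧ ‖y‖ < 2 * L}, ‖U y‖ ^ 2 ≤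
        8 * v₁ * η ^ 2 * L ^ e := by
    intro L hL
    have hL0 : 0 < L := by linarith
    set S : Set (EuclideanSpace ℝ (Fin 3)) := {y | L < ‖y‖ ∧ ‖y‖ < 2 * L} with hS_def
    have hSsub : S ⊆ closedBall (0 : EuclideanSpace ℝ (Fin 3)) (2 * L) := fun y hy => by
      rw [mem_closedBall_zero_iff]
      exact hy.2.le
    have hSfin : volume S < ⊤ := (isBounded_closedBall.subset hSsub).measure_lt_top
    have hvolS : (volume : Measure (EuclideanSpace ℝ (Fin 3))).real S ≤ 8 * v₁ * L ^ 3 := by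
      calc (volume : Measure (EuclideanSpace ℝ (Fin 3))).real S
          ≤ (volume : Measure (EuclideanSpace ℝ (Fin 3))).real
              (closedBall (0 : EuclideanSpace ℝ (Fin 3)) (2 * L)) :=
            measureReal_mono hSsub measure_closedBall_lt_top.ne
        _ = 8 * v₁ * L ^ 3 := by
            rw [hv₁_def, Measure.addHaar_real_closedBall' volume (0 : EuclideanSpace ℝ (Fin 3))
              (by linarith : (0 : ℝ) ≤ 2 * L), finrank_euclideanSpace_fin]
            ring
    -- pointwise bound on the shell
    have hpt : ∀ y ∈ S, ‖(‖U y‖ ^ 2)‖ ≤ η ^ 2 * L ^ (-(2 * α)) := by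
      intro y hy
      have hy0 : 0 < ‖y‖ := lt_trans hL0 hy.1
      have hyα : 0 < ‖y‖ ^ α := Real.rpow_pos_of_pos hy0 _
      have h1 : ‖U y‖ ≤ η * ‖y‖ ^ (-α) := by
        have h2 := hR y ((le_max_left _ _).trans (hL.trans hy.1.le))
        rw [Real.rpow_neg hy0.le, ← div_eq_mul_inv, le_div_iff₀ hyα, mul_comm]
        exact h2
      have h3 : ‖y‖ ^ (-α) ≤ L ^ (-α) := Real.rpow_le_rpow_of_nonpos hL0 hy.1.le (by linarith)
      have h4 : ‖U y‖ ≤ η * L ^ (-α) := h1.trans (mul_le_mul_of_nonneg_left h3 hη0.le)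
      rw [Real.norm_of_nonneg (by positivity)]
      calc ‖U y‖ ^ 2 ≤ (η * L ^ (-α)) ^ 2 := pow_le_pow_left₀ (norm_nonneg _) h4 2
        _ = η ^ 2 * L ^ (-(2 * α)) := by
            rw [mul_pow]
            congr 1
            rw [← Real.rpow_natCast (L ^ (-α)) 2, ← Real.rpow_mul hL0.le]
            congr 1
            push_cast
            ring
    have hI := norm_setIntegral_le_of_norm_le_const hSfin hpt
    rw [Real.norm_of_nonneg (integral_nonneg fun y => by positivity)] at hI
    calc ∫ y in S, ‖U y‖ ^ 2 ≤ η ^ 2 * L ^ (-(2 * α)) *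
          (volume : Measure (EuclideanSpace ℝ (Fin 3))).real S := hI
      _ ≤ η ^ 2 * L ^ (-(2 * α)) * (8 * v₁ * L ^ 3) :=
          mul_le_mul_of_nonneg_left hvolS (by positivity)
      _ = 8 * v₁ * η ^ 2 * (L ^ (-(2 * α)) * L ^ (3 : ℝ)) := by
          rw [← Real.rpow_natCast L 3]
          push_cast
          ring
      _ = 8 * v₁ * η ^ 2 * L ^ e := by
          rw [← Real.rpow_add hL0, he_def]
          ring_nf
  have hball := ball_energy_le_of_shellEnergy_le hUc hα2 hL₁0 (by positivity) hshell
  -- the head term `E(L₁) L^{2α−3} → 0`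
  set E₁ : ℝ := ∫ y in ball (0 : EuclideanSpace ℝ (Fin 3)) L₁, ‖U y‖ ^ 2 with hE₁_def
  have hE₁ : 0 ≤ E₁ := integral_nonneg fun y => by positivity
  have hlim : Tendsto (fun L : ℝ => E₁ * L ^ (-(3 - 2 * α))) atTop (𝓝 0) := by
    have := (tendsto_rpow_neg_atTop (by linarith : 0 < 3 - 2 * α)).const_mul E₁
    simpa using this
  have hev : ∀ᶠ L : ℝ in atTop, E₁ * L ^ (-(3 - 2 * α)) < ε / 2 :=
    hlim.eventually (gt_mem_nhds (by positivity))
  obtain ⟨M, hM⟩ := (hev.and (eventually_ge_atTop L₁)).exists_forall_of_atTop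
  refine ⟨M, fun L hL => ?_⟩
  obtain ⟨hLε, hLL₁⟩ := hM L hL
  have hL0 : 0 < L := by linarith
  have hpos : 0 ≤ L ^ (2 * α - 3) := Real.rpow_nonneg hL0.le _
  have h1 := hball L hLL₁
  have e1 : L ^ (2 * α - 3) = L ^ (-(3 - 2 * α)) := by
    congr 1
    ring
  have e2 : L ^ (2 * α - 3) * L ^ e = 1 := by
    rw [← Real.rpow_add hL0, he_def, show 2 * α - 3 + (3 - 2 * α) = 0 by ring, Real.rpow_zero]
  calc L ^ (2 * α - 3) * ∫ y in ball (0 : EuclideanSpace ℝ (Fin 3)) L, ‖U y‖ ^ 2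
      ≤ L ^ (2 * α - 3) * (E₁ + r / (r - 1) * (8 * v₁ * η ^ 2) * L ^ e) :=
        mul_le_mul_of_nonneg_left h1 hpos
    _ = E₁ * L ^ (-(3 - 2 * α)) + K * (8 * v₁ * η ^ 2) * (L ^ (2 * α - 3) * L ^ e) := by
        rw [← e1, hK_def]
        ring
    _ ≤ ε / 2 + ε / 2 := by rw [e2, mul_one]; exact add_le_add hLε.le hηε
    _ = ε := by ring

/-- **BS15 Theorem 1.1, `L^p` class, with an EVENTUALLY small energy** (convenience form of
`eq_zero_of_memLp_of_frequently_small`): if `∫_{|y|<L}|U|² = o(L^{3−2α})` then `U = 0`.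
[cite: BronziShvydkoy2015, §1 Thm. 1.1 and Rem. 1.3] -/
theorem IsSelfSimilarEulerProfile.eq_zero_of_memLp_of_energy_littleO {α p : ℝ}
    {U : EuclideanSpace ℝ (Fin 3) → EuclideanSpace ℝ (Fin 3)} {P : EuclideanSpace ℝ (Fin 3) → ℝ}
    (h : IsSelfSimilarEulerProfile (1 / (α + 1)) 0 U P) (hp : 3 < p) (hαp : 3 / p < α)
    (hα2 : α ≤ 3 / 2) (hU : MemLp U (ENNReal.ofReal p) volume)
    (hP : MemLp P (ENNReal.ofReal (p / 2)) volume)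
    (hsmall : ∀ ε : ℝ, 0 < ε → ∃ M : ℝ, ∀ L : ℝ, M ≤ L →
      L ^ (2 * α - 3) * ∫ y in ball (0 : EuclideanSpace ℝ (Fin 3)) L, ‖U y‖ ^ 2 ≤ ε) :
    U = 0 :=
  h.eq_zero_of_memLp_of_frequently_small hp hαp hα2 hU hP (fun _ hφ hφc => h.weakPoisson hφ hφc)
    fun ε hε M => by
      obtain ⟨M', hM'⟩ := hsmall ε hε
      exact ⟨max M M', le_max_left _ _, hM' _ (le_max_right _ _)⟩

/-- **BS15 Remark 1.4 in kernel form: an `L^p` profile decaying FASTER than the natural rate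
`|y|^{−α}` is trivial.** Let `(U, P)` be a stationary self-similar Euler profile with exponent
`γ = 1/(α+1)`, `3/p < α < 3/2` (`3 < p < ∞`), `U ∈ C² ∩ L^p(ℝ³)`, `P ∈ L^{p/2}(ℝ³)`. If
`|y|^α |U(y)| → 0` as `|y| → ∞`, then `U = 0` ("results of [He] in exterior domains suggest that
asymptotic behavior at `∞` should be that of `|y|^{−α}` in general. Theorem 1.1 expresses this very
fact only phrased in terms of `L²`-averages"): sub-natural pointwise decay makes the rescaled
energy `o(1)` (`energy_eventually_small_of_decay`), contradicting the lower bound of Theorem 1.1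
unless `U = 0`. Census reading: a claimed exact profile with collapse exponent `c_l = 1/(1+α)`
whose velocity decays faster than `|y|^{−(1/c_l − 1)}` is not an exact profile.
[cite: BronziShvydkoy2015, §1 Thm. 1.1 and Rem. 1.4] -/
theorem IsSelfSimilarEulerProfile.eq_zero_of_memLp_of_decay {α p : ℝ}
    {U : EuclideanSpace ℝ (Fin 3) → EuclideanSpace ℝ (Fin 3)} {P : EuclideanSpace ℝ (Fin 3) → ℝ}
    (h : IsSelfSimilarEulerProfile (1 / (α + 1)) 0 U P) (hp : 3 < p) (hαp : 3 / p < α)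
    (hα2 : α < 3 / 2) (hU : MemLp U (ENNReal.ofReal p) volume)
    (hP : MemLp P (ENNReal.ofReal (p / 2)) volume)
    (hdecay : ∀ η : ℝ, 0 < η → ∃ R : ℝ, ∀ y : EuclideanSpace ℝ (Fin 3), R ≤ ‖y‖ →
      ‖y‖ ^ α * ‖U y‖ ≤ η) :
    U = 0 := by
  have hp0 : 0 < p := by linarith
  have hα0 : 0 ≤ α := (lt_trans (by positivity : (0 : ℝ) < 3 / p) hαp).le
  exact h.eq_zero_of_memLp_of_energy_littleO hp hαp hα2.le hU hP
    (energy_eventually_small_of_decay h.contDiff_velocity.continuous hα0 hα2 hdecay)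

/-- **The same at `p = 3`** (`U ∈ L³`, `P ∈ L^{3/2}`, window `1 < α < 3/2`; for `α ≤ 1` the
decay hypothesis is not needed, `chaeShvydkoy2013_L3_exclusion`).
[cite: BronziShvydkoy2015, §1 Thm. 1.1 and Rem. 1.4] -/
theorem IsSelfSimilarEulerProfile.eq_zero_of_memLp_three_of_decay {α : ℝ}
    {U : EuclideanSpace ℝ (Fin 3) → EuclideanSpace ℝ (Fin 3)} {P : EuclideanSpace ℝ (Fin 3) → ℝ}
    (h : IsSelfSimilarEulerProfile (1 / (α + 1)) 0 U P) (hα0 : 0 ≤ α) (hα2 : α < 3 / 2)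
    (hU3 : MemLp U 3 volume) (hP : MemLp P (3 / 2 : ℝ≥0∞) volume)
    (hdecay : ∀ η : ℝ, 0 < η → ∃ R : ℝ, ∀ y : EuclideanSpace ℝ (Fin 3), R ≤ ‖y‖ →
      ‖y‖ ^ α * ‖U y‖ ≤ η) :
    U = 0 :=
  h.eq_zero_of_memLp_three_of_frequently_small (by linarith) hα2.le hU3 hP fun ε hε M => by
    obtain ⟨M', hM'⟩ :=
      energy_eventually_small_of_decay h.contDiff_velocity.continuous hα0 hα2 hdecay ε hε
    exact ⟨max M M', le_max_left _ _, hM' _ (le_max_right _ _)⟩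

/-- **BS15 Remark 1.4, `L^p` class, every `3 ≤ p < ∞`** (binder shape of the Chae–Shvydkoy
facts): in the window `3/p < α < 3/2`, a profile with `U ∈ L^p`, `P ∈ L^{p/2}` and
`|y|^α |U(y)| → 0` at infinity is trivial. [cite: BronziShvydkoy2015, §1 Thm. 1.1 and Rem. 1.4] -/
theorem bronziShvydkoy2015_exclusion_of_decay (α : ℝ) (p : ℝ≥0∞)
    (U : EuclideanSpace ℝ (Fin 3) → EuclideanSpace ℝ (Fin 3)) (P : EuclideanSpace ℝ (Fin 3) → ℝ)
    (h3 : 3 ≤ p) (htop : p ≠ ∞) (hαp : 3 / p.toReal < α) (hα2 : α < 3 / 2)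
    (hprof : IsSelfSimilarEulerProfile (1 / (α + 1)) 0 U P)
    (hU : MemLp U p volume) (hP : MemLp P (p / 2) volume)
    (hdecay : ∀ η : ℝ, 0 < η → ∃ R : ℝ, ∀ y : EuclideanSpace ℝ (Fin 3), R ≤ ‖y‖ →
      ‖y‖ ^ α * ‖U y‖ ≤ η) :
    U = 0 := by
  rcases eq_or_lt_of_le h3 with h3eq | h3lt
  · -- `p = 3`
    subst h3eq
    have e3 : (3 : ℝ≥0∞).toReal = 3 := by norm_num
    rw [e3] at hαp
    have hP' : MemLp P (3 / 2 : ℝ≥0∞) volume := hP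
    exact hprof.eq_zero_of_memLp_three_of_decay (by linarith) hα2 hU hP' hdecay
  · -- `3 < p < ∞`
    have hpr : 3 < p.toReal := by
      have := (ENNReal.toReal_lt_toReal (by norm_num : (3 : ℝ≥0∞) ≠ ⊤) htop).2 h3lt
      simpa using this
    have hU' : MemLp U (ENNReal.ofReal p.toReal) volume := by rwa [ENNReal.ofReal_toReal htop]
    have hP' : MemLp P (ENNReal.ofReal (p.toReal / 2)) volume := by
      rw [ENNReal.ofReal_div_of_pos two_pos, ENNReal.ofReal_toReal htop]
      simpa using hP
    exact hprof.eq_zero_of_memLp_of_decay hpr hαp hα2 hU' hP' hdecay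

/-! ## BS15 Remark 1.2 (energy concentration) in the `L^p` class, without the named fact -/

/-- Translating a ball integral: `∫_{B_ρ(x₀)} f(x − x₀) dx = ∫_{B_ρ(0)} f(z) dz` (Lebesgue measure
on `ℝ³` is translation invariant; the same private helper as in
`SelfSimilarEulerEnergyConcentration.lean`). [folklore] -/
private theorem setIntegral_comp_sub_ball_aux (f : EuclideanSpace ℝ (Fin 3) → ℝ)
    (x₀ : EuclideanSpace ℝ (Fin 3)) (ρ : ℝ) :
    ∫ x in ball x₀ ρ, f (x - x₀) = ∫ z in ball (0 : EuclideanSpace ℝ (Fin 3)) ρ, f z := by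
  rw [← integral_indicator measurableSet_ball, ← integral_indicator measurableSet_ball]
  have hind : (ball x₀ ρ).indicator (fun x => f (x - x₀)) =
      fun x => (ball (0 : EuclideanSpace ℝ (Fin 3)) ρ).indicator f (x - x₀) := by
    funext x
    have hmem : x ∈ ball x₀ ρ ↔ x - x₀ ∈ ball (0 : EuclideanSpace ℝ (Fin 3)) ρ := by
      rw [mem_ball, mem_ball, dist_eq_norm, dist_zero_right]
    by_cases hx : x ∈ ball x₀ ρ
    · rw [indicator_of_mem hx, indicator_of_mem (hmem.1 hx)]
    · rw [indicator_of_notMem hx, indicator_of_notMem (fun h => hx (hmem.2 h))]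
  rw [hind]
  exact integral_sub_right_eq_self _ x₀

/-- **BS15 Remark 1.2 (energy concentration) for `L^p` profiles — no named fact.** "In view of
(1.5), the conclusion of the theorem states that unless the profile `v` is trivial, the
self-similar blowup carries some positive amount of energy with it, i.e.
`‖u(t)‖_{L²(B_{ρ₀}(x₀))}` stays bounded away from zero as time `t` approaches critical."  Kernel
form in the Chae–Shvydkoy integrability class: let `(v, q)` be a stationary self-similar Euler
profile with exponent `γ = 1/(α+1)`, `v ∈ C² ∩ L^p(ℝ³)`, `q ∈ L^{p/2}(ℝ³)`, `3 ≤ p < ∞`,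
`3/p < α ≤ 3/2`, `v ≠ 0`, and let `u` be ANY field which on the ball `B_{ρ₀}(x₀) × [0,T)` equals the
collapse `u(t,x) = (T−t)^{γ−1} v((T−t)^{−γ}(x − x₀))` (no equation for `u` is needed: the profile
system is the hypothesis). Then there are `c > 0` and `0 ≤ t₁ < T` with
`∫_{B_{ρ₀}(x₀)} |u(t,x)|² dx ≥ c` for all `t ∈ [t₁, T)`; indeed `c = c₁ ρ₀^{3−2α}` with the lower
constant `c₁` of the two-sided law `bronziShvydkoy2015_dichotomy_of_memLp`, by the exact scaling
(1.5) `‖u(t)‖²_{L²(B_{ρ₀}(x₀))} = (T−t)^{2(γ−1)+3γ} ∫_{|y|<ρ₀(T−t)^{−γ}} |v|²`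
(`setIntegral_norm_sq_selfSimilarCollapse_ball`) and `2(γ−1) + 3γ − γ(3−2α) = 0`. For an exact
locally self-similar collapse of a classical Euler solution the pressure profile `q` exists by
`exists_pressureProfile_of_locallySelfSimilar` (`SelfSimilarEulerPressureRecovery.lean`); only its
integrability is a hypothesis here. Census reading: in this class the energy inside the FIXED
physical ball around the collapse point does not drain as `t → T` (a K-print: local energy
non-evacuation), the fact-conditional `bronziShvydkoy2015_energy_dichotomy.energy_ball_lower_bound`
made unconditional for `L^p` profiles. [cite: BronziShvydkoy2015, §1 Thm. 1.1 and Rem. 1.2] -/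
theorem energy_ball_lower_bound_of_selfSimilarCollapse_of_memLp (α : ℝ) (p : ℝ≥0∞)
    {T ρ₀ : ℝ} {x₀ : EuclideanSpace ℝ (Fin 3)}
    {u : ℝ → EuclideanSpace ℝ (Fin 3) → EuclideanSpace ℝ (Fin 3)}
    {v : EuclideanSpace ℝ (Fin 3) → EuclideanSpace ℝ (Fin 3)} {q : EuclideanSpace ℝ (Fin 3) → ℝ}
    (h3 : 3 ≤ p) (htop : p ≠ ∞) (hαp : 3 / p.toReal < α) (hα2 : α ≤ 3 / 2)
    (hprof : IsSelfSimilarEulerProfile (1 / (α + 1)) 0 v q)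
    (hU : MemLp v p volume) (hP : MemLp q (p / 2) volume)
    (hT : 0 < T) (hρ₀ : 0 < ρ₀)
    (hss : ∀ t ∈ Ico 0 T, ∀ x ∈ ball x₀ ρ₀,
      u t x = selfSimilarCollapse (1 / (α + 1)) T v t (x - x₀))
    (hv : v ≠ 0) :
    ∃ c t₁ : ℝ, 0 < c ∧ 0 ≤ t₁ ∧ t₁ < T ∧ ∀ t ∈ Ico t₁ T,
      c ≤ ∫ x in ball x₀ ρ₀, ‖u t x‖ ^ 2 := by
  obtain ⟨c, C, L₀, hc, hbd⟩ :=
    (bronziShvydkoy2015_dichotomy_of_memLp α p v q h3 htop hαp hα2 hprof hU hP).resolve_left hv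
  have hα0 : 0 < α := by
    have : 0 ≤ 3 / p.toReal := div_nonneg (by norm_num) ENNReal.toReal_nonneg
    linarith
  have hα1 : 0 < α + 1 := by linarith
  set γ : ℝ := 1 / (α + 1) with hγ_def
  have hγ : 0 < γ := by rw [hγ_def]; positivity
  -- threshold time: for `T - t ≤ s₁ := (max L₀ 1 / ρ₀)^{-(α+1)}` the radius `ρ₀ (T−t)^{−γ}` is `≥ L₀`
  set M : ℝ := max L₀ 1 with hM_def
  have hM : 0 < M := lt_of_lt_of_le one_pos (le_max_right _ _)
  have hMρ : 0 < M / ρ₀ := div_pos hM hρ₀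
  set s₁ : ℝ := (M / ρ₀) ^ (-(α + 1)) with hs₁_def
  have hs₁ : 0 < s₁ := Real.rpow_pos_of_pos hMρ _
  refine ⟨c * ρ₀ ^ (3 - 2 * α), max 0 (T - s₁), mul_pos hc (Real.rpow_pos_of_pos hρ₀ _),
    le_max_left _ _, max_lt hT (by linarith), fun t ht => ?_⟩
  have ht0 : 0 ≤ t := (le_max_left _ _).trans ht.1
  have htT : t < T := ht.2
  have hs : 0 < T - t := sub_pos.mpr htT
  have hsle : T - t ≤ s₁ := by linarith [(le_max_right _ _).trans ht.1]
  -- the self-similar radius at time `t`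
  set L : ℝ := ρ₀ * (T - t) ^ (-γ) with hL_def
  have hradius : M ≤ L := by
    have h1 : s₁ ^ (-γ) ≤ (T - t) ^ (-γ) :=
      Real.rpow_le_rpow_of_nonpos hs hsle (by linarith)
    have h2 : s₁ ^ (-γ) = M / ρ₀ := by
      rw [hs₁_def, ← Real.rpow_mul hMρ.le]
      have : -(α + 1) * -γ = 1 := by rw [hγ_def]; field_simp
      rw [this, Real.rpow_one]
    rw [h2] at h1
    calc M = ρ₀ * (M / ρ₀) := by field_simp
      _ ≤ ρ₀ * (T - t) ^ (-γ) := by gcongr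
  have hL₀L : L₀ ≤ L := (le_max_left _ _).trans hradius
  -- the energy in the ball, by translation and exact scaling
  have hball : ∫ x in ball x₀ ρ₀, ‖u t x‖ ^ 2 =
      ∫ x in ball x₀ ρ₀, ‖selfSimilarCollapse γ T v t (x - x₀)‖ ^ 2 := by
    refine setIntegral_congr_fun measurableSet_ball fun x hx => ?_
    rw [hss t ⟨ht0, htT⟩ x hx]
  rw [hball, setIntegral_comp_sub_ball_aux (fun z => ‖selfSimilarCollapse γ T v t z‖ ^ 2) x₀ ρ₀,
    setIntegral_norm_sq_selfSimilarCollapse_ball htT v ρ₀]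
  -- lower bound at radius `L`
  have hlow : c * L ^ (3 - 2 * α) ≤
      ∫ y in ball (0 : EuclideanSpace ℝ (Fin 3)) L, ‖v y‖ ^ 2 := (hbd L hL₀L).1
  have hpre : 0 < (T - t) ^ (2 * (γ - 1) + 3 * γ) := Real.rpow_pos_of_pos hs _
  -- `(T−t)^{2(γ−1)+3γ} · L^{3−2α} = ρ₀^{3−2α}`
  have hscale : (T - t) ^ (2 * (γ - 1) + 3 * γ) * L ^ (3 - 2 * α) = ρ₀ ^ (3 - 2 * α) := by
    rw [hL_def, Real.mul_rpow hρ₀.le (Real.rpow_pos_of_pos hs _).le, ← Real.rpow_mul hs.le,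
      mul_left_comm, ← Real.rpow_add hs]
    have : 2 * (γ - 1) + 3 * γ + -γ * (3 - 2 * α) = 0 := by
      rw [hγ_def]; field_simp; ring
    rw [this, Real.rpow_zero, mul_one]
  calc c * ρ₀ ^ (3 - 2 * α)
      = (T - t) ^ (2 * (γ - 1) + 3 * γ) * (c * L ^ (3 - 2 * α)) := by
        rw [← hscale]; ring
    _ ≤ (T - t) ^ (2 * (γ - 1) + 3 * γ) *
          ∫ y in ball (0 : EuclideanSpace ℝ (Fin 3)) L, ‖v y‖ ^ 2 :=
        mul_le_mul_of_nonneg_left hlow hpre.le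
    _ = (T - t) ^ (2 * (γ - 1) + 3 * γ) *
          ∫ y in ball (0 : EuclideanSpace ℝ (Fin 3)) (ρ₀ * (T - t) ^ (-γ)), ‖v y‖ ^ 2 := by
        rw [hL_def]

end Literature.Analysis.FluidPDE

end
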